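import Literature.MathematicalPhysics.QuantumFieldTheory.Balaban1983to89.B12WTReduction429
import Literature.MathematicalPhysics.QuantumFieldTheory.Balaban1983to89.B14Eq350Kernel

/-!
# `Balaban1983to89.B14.Eq349WardReduction` — [Balaban1988Convergent] (3.49) p. 280 DERIVED from the Ward–Takahashi
# identities (I.4.14), (I.4.15): «we move the factors B to the point z» — an exact identity with every
# «irrelevant term» explicit, its power counting, and the hypotheses discharged in the chart `B ↦ 𝐄(exp iB)`

statement-level skeleton of published theorems with citation tags; proofs where landed; nothing here is a
claim about the Yang–Mills mass gap

PDF held: `paper:balaban1988-cmp119-convergent-renormalization` (journal page = PDF page + 242); (3.48)–(3.51) READ AS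
AN IMAGE on the x2 render `…-p038-x2.png` (p. 280) of
`run/shared/lean/pub/pub-balaban/b2b-balaban-ref1/pages/1988-cmp119-convergent-renormalization/` by the author of this
file (2026-08-21); p. 281 («Let us recall that (the irrelevant terms) …») as quoted in the header of `…B14.Eq350Kernel`
(same reader, gen 3, render `…-p039-x2.png`).  The [I]-side displays (4.14), (4.15), (4.16)–(4.18), (4.21)–(4.31),
(4.34) are quoted from the headers of the imported pub-balaban lineage files `…B12Semisimple414`, `…B12WardSecond415`,
`…B12WardThird415`, `…B12WTReduction429`, `…B12Marginal444` (whose authors read the CMP 109 renders); nothing inside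
quotation marks is altered.

CITATION HEADER (lean-in-tree rule).  Source: T. Bałaban, *Convergent renormalization expansions for lattice gauge
theories*, Commun. Math. Phys. **119**, 243–285 (1988), doi:10.1007/bf01217741 [Balaban1988Convergent] (cell paper
B14 = "[III]"), p. 280; its reference [I] = T. Bałaban, *Renormalization group approach to lattice gauge field
theories. I*, Commun. Math. Phys. **109**, 249–301 (1987), doi:10.1007/bf01215223 [Balaban1987RG1] (cell paper B12),
§4 pp. 282–289.  Mega-formalization `lit-balaban` (HOME `run/shared/lean/pub/lit-balaban/`), reader/typer unit
`lit-balaban-r11` (generation 9), SKELETON row **B14.Eq3.49–3.50** (decls of record so far: `…B14.Eq350Kernel.{taylor4,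
E2, kernel350, main349, Eq349}` — the display typed as a Prop with an explicit irrelevant term —, `…B14.Eq349Remainder.*`
— the fifth-order part of the irrelevant terms bounded —, `…B14.Lem280WardLie.*`; the row's head listed «the position-
space Taylor part of the irrelevant terms and the WT manipulations of Sect. 4 [I] NOT typed»: THIS FILE supplies them).
Imports the pub-balaban lineage module `…B12WTReduction429` (unit `b2b-balaban-b03`, gen 26; through it
`…B12WardThird415`, `…B12WardSecond415`, `…B12Schur433`, `…B12Semisimple414`, Mathlib) and (v1.1, §6) the row's own
`…B14Eq350Kernel` (gen 3: `taylor4`, `dTensor`, `main349`, `Eq349`, `valueAt`; through it `…B14.Eq356FieldStrength`: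
`halfTerm`, `pairTrace`, `moment2`); uses BY NAME
`B12WTReduction429.wt_chart_of_bracket` ((I.4.15)₁,₂,₃ at `B = 0` in the chart), `B12Semisimple414.fderiv_chart_zero_eq_zero`
((I.4.14)), `B12Semisimple414.span_commutatorSet_eq_top_of_isSemisimple`, `B12Schur433.hessian_chart_symm`,
`B12WardThird415.{fderiv_fderiv_fderiv_apply_swap_left, fderiv_fderiv_fderiv_apply_swap_right, contDiffAt_three_comp_chart,
iteratedFDeriv_four_apply}`, `B12WardSecond415.iteratedFDeriv_three_apply`; modifies nothing; NO `def`, no new `Prop`,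
no named fact (D-0026: theorems only).

THE PRINTED TEXT (verbatim, p. 280 [PDF 38]).  *"To the sum on the right-hand side (I.3.34) we apply the considerations of
Sect. 4 [I], with two differences only. We do not differentiate with respect to t_□ yet, hence all the factors B in the
sum are the same, and applying the Ward-Takahashi identities (I.4.14), (I.4.15), and other operations of that section, we
move the factors B to the point z instead of the point x. The final formula we obtain is slightly different from the
formula (I.4.34). We have
  Σ_{n=1}^{4} (1/n!) ⟨𝐄^{(n)}(X, z), ⊗ⁿ B⟩ = Σ_{μ,ν,κ,λ} [Σ_{x,y} 𝐄^{(2)}_{μν}(X, x, y, z)(x_κ − z_κ)(y_λ − z_λ)]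
      · ½ tr((∂_κB_μ)(z) + ½ i[B_κ(z), B_μ(z)])((∂_λB_ν)(z) + ½ i[B_λ(z), B_ν(z)]) + (the irrelevant terms)   (3.49)
As in Sect. 4 [I] we have dropped the superscript (j) in the symbols above, the superscripts written denote the functional
derivatives with respect to B."*  p. 281 [PDF 39]: *"Let us recall that (the irrelevant terms) above, and in (3.49),
denotes the sum of terms which can be bounded by O((LʲL⁻ⁿ)^{5−β}) exp(−κd_j(X)), where β is a positive number."*
[I] p. 284, as quoted by `…B12Semisimple414` / `…B12WardThird415`: (4.14) *"(δ/δB)𝐄(1) = 0"* («The group G is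
semisimple, hence»); (4.15) *"⟨(δ²/δB²)𝐄(1), B₁, ∂λ⟩ = 0, ⟨(δ³/δB³)𝐄(1), B₁, B₂, ∂λ⟩ − ⟨(δ²/δB²)𝐄(1), B₁, i[λ₋, B₂] −
½i[B₂, ∂λ]⟩ − (B₁↔B₂) = 0, ⟨(δ⁴/δB⁴)𝐄(1), B₁,B₂,B₃, ∂λ⟩ − ⟨(δ³/δB³)𝐄(1), B₁,B₂, i[λ₋,B₃] − ½i[B₃,∂λ]⟩ − (B₃↔B₂) −
(B₃↔B₁) + ⟨(δ²/δB²)𝐄(1), B₁, k₂{iad_{B₂}, iad_{B₃}}∂λ⟩ + (B₁↔B₂) + (B₁↔B₃) = 0, (4.15) for an arbitrary gauge function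
λ, and arbitrary gauge fields B₁, B₂, B₃"*; [I] p. 286 (4.23) *"λ_x(x₃) = Σ_{ν=1}^{4} (x_{3,ν} − x_ν)B_ν(x)"*, p. 288
*"Let us denote B_{μ₃}(x₃, x) = Σ_{ν=1}^{4} (x_{3,ν} − x_ν)(∂_νB_{μ₃})(x)"*, *"The difference B(·) − B(x) = (∂B)(Γ_{x,·})
gives rise to irrelevant terms"*.

THE MATHEMATICS (print's, with «the point x» of [I] §4 replaced by the localization point `z` and no `δB`).  Write
`B = c + ℓ + r` with `c = B(z)` the constant field («the factors B … at the point z»), `ℓ = B(·, z)` the linear Taylor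
term and `r` the second-order Taylor remainder of (I.4.30); let `λ_z(x) = Σ_κ (x_κ − z_κ)B_κ(z)`, so that `∂λ_z = c`
((I.4.23) at `z`) and `m := i[λ_z, c]`, `m_μ(x) = Σ_κ (x_κ − z_κ) i[B_κ(z), B_μ(z)]`.  Then: `n = 1`: `⟨𝐄^{(1)}, B⟩ = 0`
by (I.4.14).  `n = 2`: every slot `c = ∂λ_z` is killed by (I.4.15)₁, `½⟨𝐄^{(2)}, B, B⟩ = ½⟨𝐄^{(2)}, ℓ, ℓ⟩ + O(r)`.
`n = 3`: (I.4.15)₂ with `∂λ = c`, twice, `⅙⟨𝐄^{(3)}, B, B, B⟩ = ½⟨𝐄^{(2)}, ℓ, m⟩ + (dimension ≥ 5)`.  `n = 4`: (I.4.15)₃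
at `B₁ = B₂ = B₃ = c` then (I.4.15)₂, `(1/24)⟨𝐄^{(4)}, ⊗⁴B⟩ = ⅛⟨𝐄^{(2)}, m, m⟩ + (dimension ≥ 5)`.  Sum:
`½⟨𝐄^{(2)}, ℓ + ½m, ℓ + ½m⟩` — and with the scalar kernel table of (3.50)/(I.4.33) («⟨𝐄, A⊗B⟩ = 𝐄 tr AB») this IS the
displayed right-hand side of (3.49), since `(ℓ + ½m)_μ(x) = Σ_κ (x_κ − z_κ)((∂_κB_μ)(z) + ½ i[B_κ(z), B_μ(z)])`.  What the
reduction uses of the Lie algebra is bilinearity and `[a, a] = 0` only; of `λ_z`, `ℓ` NOTHING (they are letters) — the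
identity is exact for EVERY decomposition `B = c + ℓ + (B − c − ℓ)` and every pair `(λ_z, c)` satisfying (I.4.15).

THE DICTIONARY (= that of `…B12WTReduction429`, items (ii), (iii), (vi), (vii) verbatim).  Towers `E1, …, E4` on the
bond fields `Λ → T → V` (`Λ` directions, `T` sites, `V ≅ 𝔤`); in §2 ANY towers with the slot symmetries derivatives have
(`T` an arbitrary type), in §4 the derivatives at `B = 0` of the chart functional `f(B) = ℰ(exp ρB)` of [I] §4 (gens
21–24 of the pub-balaban B12 lineage: bonds `(y, y + e_ν)` of a finite additive group `T`, `ρ : V →L[ℝ] 𝔄` absorbing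
print's factors `i`, `ℰ` `C⁴` at `1` and gauge invariant (I.4.7) near `1`).  `i[·,·] ↦ br` (bilinear, alternating);
`λ_z ↦ lam : T → V`; `∂λ_z = B(z) ↦ c`; `B(·, z) ↦ ℓ`; the Taylor remainder `↦ B − c − ℓ`; (I.4.14) `↦ h14 : E1 = 0`;
(I.4.15)₁,₂,₃ `↦ h1, h2, h3` in EXACTLY the shapes `…B12WTReduction429` states and discharges (`k₂ = 1/12`).
«(the irrelevant terms)» ↦ FOURTEEN EXPLICIT TERMS `R₁, …, R₁₄` (listed at `eq349_abstract`).  MODEL NOTES.  (M1) As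
in `…B12WTReduction429`: on the finite torus of the chart an affine `λ_z` does not exist; the chart theorems hold for
every pair `(λ_z, c = ∂λ_z)`, print's affine `λ_z` with CONSTANT gradient `B(z)` lives on `ℤ^Λ`
(`B12WTReduction429.eq423_affine`), to which §2 applies verbatim.  (M2) For matrix-valued `B` print reads the invariant
bilinear kernel as scalar table × trace form ((I.4.33), `…B12Schur433`); §5 takes the table `K` and the form `tr2` as
data.  (M3) The sums over `X`, `z` and the pairing with Bałaban's kernels are not modelled (as in the lineage: identities
summand by summand).  (M4) Power counting (§3): print's (I.4.16)–(I.4.18) «in the L⁻ⁿ-scale» (p. 280) are the HYPOTHESES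
`‖c‖ ≤ aσ`, `‖λ_z‖ ≤ aσ`, `‖ℓ‖ ≤ aσ²`, `‖B − c − ℓ‖ ≤ aσ²τ`, `σ = LʲL⁻ⁿ`, `τ = σ^β`; the tower bounds `e_n` carry print's
`exp(−κd_j(X))` ((3.48)); print's exponent «5 − β» is matched as `4 + β′ = 5 − (1 − β′)`.

WHAT IS PROVED (kernel-checked, zero `sorry`, standard axioms; NO definitions):
* §1 `kappa_split`, `k2_term_eq` — bond-wise bracket bookkeeping (`i[B(z), B(z)] = 0`).
* §2 ABSTRACT, `T` arbitrary: `term2_eq` (n = 2, needs `h1`, `hs2`), `term3_eq` (n = 3, needs `h1`, `h2`, symmetries),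
  `term4_eq` (n = 4, needs `h1`, `h2`, `h3`, symmetries), **`eq349_abstract`** — (3.49) as an EXACT identity
  `E1 B + ½E2 B B + ⅙E3 B B B + (1/24)E4 B B B B = ½E2 (ℓ + ½m)(ℓ + ½m) + (R₁ + ⋯ + R₁₄)`, coefficients `½, ½, ⅛` of
  `ℓℓ`, `ℓm`, `mm` confirmed by the kernel as the unique closing combination (they are print's `½ tr(∂B + ½i[B,B])²`).
* §3 POWER COUNTING on finite index types: `norm_kappa_le` (+ private sup-norm helpers),
  **`remainder349_norm_le`** — `‖R₁ + ⋯ + R₁₄‖ ≤ K(e₂,e₃,e₄,a,b)·σ⁴τ` with the explicit polynomial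
  `K = (3/2)e₂a² + (10/3)e₂a³b + (9/8)e₂a⁴b² + (5/2)e₃a³ + (33/8)e₃a⁴b + (9/4)e₄a⁴` (each `Rᵢ` is `O(σ⁵)` or
  `O(σ⁴τ)`; the main term is `O(σ⁴)`).
* §4 IN THE CHART: `taylor4_diag_eq` (print's `Σ_{n=1}^{4}(1/n!)⟨𝐄^{(n)}, ⊗ⁿB⟩` via `iteratedFDeriv` = the curried sum),
  `fderiv_chart_apply_eq_zero` ((I.4.14) kills `n = 1`), **`eq349_chart_of_bracket`** (every hypothesis of §2 discharged
  from (I.4.7), `C⁴`, perfectness, for any `ρ`-compatible alternating `br`), **`eq349_chart_of_isSemisimple`** (`𝔤` a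
  finite-dimensional semisimple real Lie algebra, `br` its bracket: only the ANALYTIC hypotheses — (I.4.7) near `1` for
  all `𝔤`-valued gauge functions, `C⁴` at `1` — and the pair `(λ_z, c = ∂λ_z)` remain).
* §5 `mainField_apply`, **`main349_display`** — with a scalar kernel table (`⟨E2,u,v⟩ = Σ K_{μν}(x,y) tr2(u_μ(x), v_ν(y))`)
  and the Taylor data at `z`, the main term of `eq349_abstract` equals print's displayed
  `Σ_{μνκλ}[Σ_{x,y}K_{μν}(x,y)(x_κ−z_κ)(y_λ−z_λ)] · ½ tr2((∂_κB_μ)(z) + ½i[B_κ(z),B_μ(z)], (∂_λB_ν)(z) + ½i[B_λ(z),B_ν(z)])`.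
* §6 (v1.1) `main349_display'`, `halfTerm_eq_real_smul`, `dTensor_eq_curried`, **`eq349_of_record`** — THE ROW'S DECL OF
  RECORD `B14.Eq350Kernel.Eq349 F B K (univ ×ˢ univ) coord z dB (valueAt B z) R` INHABITED with the explicit
  `R = R₁ + ⋯ + R₁₄`: for a real function `F` of the matrix-valued bond field (`M_m(ℂ)`, the sup-of-L¹ operator norm of
  `…B14.Eq350Kernel` §3 as local instance) with `F ∘ uncurry` `C⁴` at `0`, (I.4.14)/(I.4.15)₁,₂,₃ for its derivative
  towers with the bracket `i(ab − ba)`, and a scalar kernel table `K` against `Re tr` for its Hessian; `taylor4 F B`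
  (Mathlib `iteratedFDeriv` on the uncurried field, `dTensor_eq_curried` via `ContinuousLinearEquiv.iteratedFDerivWithin_
  comp_right`) on the left, `main349` (`moment2` × `pairTrace` of `halfTerm`) on the right.  The three identities (§2 for
  the towers, §4's `taylor4_diag_eq`, §5) are composed by unification, the matrix instance paths agreeing up to unfolding.
WHAT IS NOT PROVED HERE (and not claimed): the existence / analyticity / gauge invariance / localization of Bałaban's
`𝐄^{(j)}(X, U, z)` and the identification of its `B`-derivatives with the chart towers on the actual domains (rows
B14.Eq2.27, B12 §§2–3); the scalings (I.4.16)–(I.4.18) of the actual background field and the Taylor formula (I.4.30)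
(here hypotheses on letters); the tree-decay constants inside `e_n`; the antisymmetrization (3.51)–(3.56) (rows
B14.Lem@280, `…B14Sect3`, `…B14.Eq356FieldStrength`); anything about β_k, (3.57)–(3.64), or the continuum limit.

KERNEL FINDINGS (information about print, not objections): (α) (3.49) is an exact identity modulo the fourteen listed
terms, for abstract towers, from (I.4.14)+(I.4.15) ALONE — no Jacobi identity, no property of `λ_z` or `B(·,z)`, and
semisimplicity only through (I.4.14)/(I.4.15)₁; (β) the census of what «(the irrelevant terms)» of (3.49) covers at this
order: two terms with the second-order Taylor remainder (`R₁, R₂, R₅` carry `r`; `O(σ⁴τ)`) and eleven of `B`-dimension 5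
(`O(σ⁵)`), among them `−(1/48)⟨𝐄^{(2)}, B, i[B, i[B − B(z), B(z)]]⟩` from the `k₂`-terms of (I.4.15)₃ and the
`B`-cubic `⅓⟨𝐄^{(2)}, r, i[λ_z, B(z)]⟩`; (γ) compared with (I.4.34) (δB at x, weights 1/(n−1)!) the undifferentiated
version has NO first-moment block and NO `⟨𝐄^{(2)}, B(z), ·⟩` block — both are killed outright by (I.4.15)₁ because
`B(z) = ∂λ_z` may sit in either slot — which is print's «slightly different from the formula (I.4.34)».

HONEST FRAMING: value = the B14-side knit the row lacked — [III] (3.49) now follows BY NAME from the tree's [I] §4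
Ward–Takahashi theorems (pub-balaban gens 21–26) for the chart functional of any gauge-invariant `C⁴` `ℰ` with semisimple
charge algebra, as an exact identity with print's irrelevant terms listed and power-counted.  NOT summit progress:
bookkeeping of printed displays; every analytic statement about Bałaban's effective actions remains a hypothesis.
-/

namespace Literature.MathematicalPhysics.QuantumFieldTheory.Balaban1983to89.B14.Eq349WardReduction

open NormedSpace (exp)
open Filter
open _root_.Topology

/-! ## §1. Pointwise bracket bookkeeping: `B = B(z) + (B − B(z))` inside print's `i[λ_z, ·] − ½ i[·, ∂λ_z]` -/

section Pointwise

variable {Λ T : Type*} {V : Type*} [AddCommGroup V] [Module ℝ V]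

/-- The variation `i[λ_z, u] − ½ i[u, ∂λ_z]` of (I.4.15)₂,₃ is linear in `u`; at `u = B = c + (B − c)` (`c` standing
for `∂λ_z = B(z)`) it splits as `i[λ_z, B(z)] + (i[λ_z, B − B(z)] − ½ i[B − B(z), B(z)])`, the term
`−½ i[B(z), B(z)]` vanishing bond by bond (`hself`). [cite: Balaban1987RG1, (4.15) p.284; Balaban1988Convergent, p.280] -/
theorem kappa_split (br : V →ₗ[ℝ] V →ₗ[ℝ] V) (hself : ∀ a, br a a = 0) (lam : T → V) (c B : Λ → T → V) :
    (fun ν y => br (lam y) (B ν y) - (2 : ℝ)⁻¹ • br (B ν y) (c ν y)) =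
      (fun ν y => br (lam y) (c ν y))
        + (fun ν y => br (lam y) ((B - c) ν y) - (2 : ℝ)⁻¹ • br ((B - c) ν y) (c ν y)) := by
  funext ν y
  simp only [Pi.add_apply, Pi.sub_apply, map_sub, LinearMap.sub_apply, hself, sub_zero]
  module

/-- `i[B, ∂λ_z] = i[B − B(z), B(z)]` bond by bond (`i[B(z), B(z)] = 0`): print's «k₂(iad_B)²∂λ» term of (I.4.15)₃
at `B₁ = B₂ = B₃ = B` is `(1/6) i[B, i[B − B(z), B(z)]]`. [cite: Balaban1987RG1, (4.15) p.284, p.287] -/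
theorem k2_term_eq (br : V →ₗ[ℝ] V →ₗ[ℝ] V) (hself : ∀ a, br a a = 0) (c B : Λ → T → V) :
    (fun ν y => (12 : ℝ)⁻¹ • (br (B ν y) (br (B ν y) (c ν y)) + br (B ν y) (br (B ν y) (c ν y)))) =
      (6 : ℝ)⁻¹ • fun ν y => br (B ν y) (br ((B - c) ν y) (c ν y)) := by
  funext ν y
  simp only [Pi.smul_apply, Pi.sub_apply, map_sub, LinearMap.sub_apply, hself, sub_zero]
  module

end Pointwise

/-! ## §2. The abstract reduction: towers `E1, …, E4` with (I.4.14), (I.4.15)₁,₂,₃ at `B = 0` as hypotheses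

Throughout: `E1, E2, E3, E4` continuous multilinear towers on the `𝔤`-valued bond fields `Λ → T → V` (print's
`𝐄^{(1)}(X,z), …, 𝐄^{(4)}(X,z)`, the functional derivatives of `B ↦ 𝐄^{(j)}(X, U_j(exp iB), z)` at `B = 0`), `hs2`,
`hs3l`, `hs3r` their slot symmetries; `br` the bracket `i[·,·]` (`hself : br a a = 0`); `lam = λ_z` the gauge
function of the point `z`, `c` the field standing for `∂λ_z = B(z)` («the factors B … at the point z»), `ℓ` the field
standing for the linear Taylor term `B(·, z) = Σ_κ (·_κ − z_κ)(∂_κB)(z)`, `B` the field, so that `B − c − ℓ` is the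
second-order Taylor remainder; `h14 : E1 = 0` is (I.4.14), `h1`, `h2`, `h3` are (I.4.15)₁,₂,₃ at `B = 0` with
`∂λ ↦ c`, in exactly the shapes of `…B12WTReduction429` (there discharged in the chart).  `T` is an arbitrary type. -/

section Abstract

variable {Λ T : Type*} {V : Type*} [NormedAddCommGroup V] [NormedSpace ℝ V] {F : Type*} [NormedAddCommGroup F]
  [NormedSpace ℝ F]

/-- **The `n = 2` term of (3.49)**: `⟨E2, B, B⟩ = ⟨E2, ℓ, ℓ⟩ + (2⟨E2, ℓ, B − c − ℓ⟩ + ⟨E2, B − c − ℓ, B − c − ℓ⟩)` —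
the slots `B = c + (B − c)` with (I.4.15)₁ `⟨E2, ·, ∂λ_z⟩ = 0` killing every `c`, then `B − c = ℓ + (B − c − ℓ)`.
EXACT; the bracketed terms carry the second-order Taylor remainder `B − c − ℓ` (print: irrelevant).
[cite: Balaban1988Convergent, (3.49) p.280; Balaban1987RG1, (4.15) p.284] -/
theorem term2_eq (E2 : (Λ → T → V) →L[ℝ] (Λ → T → V) →L[ℝ] F) (hs2 : ∀ u v, E2 u v = E2 v u)
    (c ℓ B : Λ → T → V) (h1 : ∀ u, E2 u c = 0) :
    E2 B B = E2 ℓ ℓ + ((2 : ℝ) • E2 ℓ (B - c - ℓ) + E2 (B - c - ℓ) (B - c - ℓ)) := by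
  have S1 : E2 B B = E2 B c + E2 B (B - c) := by rw [← map_add]; congr 1; abel
  have S2 : E2 B (B - c) = E2 c (B - c) + E2 (B - c) (B - c) := by
    rw [← add_apply, ← map_add]; congr 2; abel
  have Z1 : E2 B c = 0 := h1 B
  have Z2 : E2 c (B - c) = 0 := by rw [hs2]; exact h1 _
  have S3 : E2 (B - c) (B - c) = E2 (B - c) ℓ + E2 (B - c) (B - c - ℓ) := by rw [← map_add]; congr 1; abel
  have S4 : E2 (B - c) ℓ = E2 ℓ ℓ + E2 (B - c - ℓ) ℓ := by
    rw [← add_apply, ← map_add]; congr 2; abel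
  have S5 : E2 (B - c) (B - c - ℓ) = E2 ℓ (B - c - ℓ) + E2 (B - c - ℓ) (B - c - ℓ) := by
    rw [← add_apply, ← map_add]; congr 2; abel
  have Y : E2 (B - c - ℓ) ℓ = E2 ℓ (B - c - ℓ) := hs2 _ _
  linear_combination (norm := module) S1 + S2 + Z1 + Z2 + S3 + S4 + S5 + Y

/-- **The `n = 3` term of (3.49)**: with `m = i[λ_z, B(z)]` (`fun ν y => br (lam y) (c ν y)`) and print's variation
`κ(u) = i[λ_z, u] − ½ i[u, ∂λ_z]`,
`⟨E3, B, B, B⟩ = 3⟨E2, ℓ, m⟩ + (2⟨E2, B − c − ℓ, m⟩ + 2⟨E2, B − c, κ(B − c)⟩ + ⟨E3, B, B, B − c − ℓ⟩ + ⟨E3, ℓ, B, B − c⟩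
  + ⟨E2, ℓ, κ(B − c)⟩ + ⟨E2, B − c, κ(ℓ)⟩)` EXACTLY — the last slot `B = c + (B − c)`, (I.4.15)₂ at `(B, B)` and at
`(ℓ, B)`, (I.4.15)₁, `κ(B) = m + κ(B − c)` (`kappa_split`), the slot symmetries of `E3`.  The six bracketed terms
are print's irrelevant terms of this order (each of `B`-dimension ≥ 5 or carrying `B − c − ℓ`).
[cite: Balaban1988Convergent, (3.49) p.280; Balaban1987RG1, (4.15) p.284, (4.30)-(4.31) pp.288-289] -/
theorem term3_eq (E2 : (Λ → T → V) →L[ℝ] (Λ → T → V) →L[ℝ] F)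
    (E3 : (Λ → T → V) →L[ℝ] (Λ → T → V) →L[ℝ] (Λ → T → V) →L[ℝ] F)
    (hs2 : ∀ u v, E2 u v = E2 v u) (hs3l : ∀ u v w, E3 u v w = E3 v u w) (hs3r : ∀ u v w, E3 u v w = E3 u w v)
    (br : V →ₗ[ℝ] V →ₗ[ℝ] V) (hself : ∀ a, br a a = 0) (lam : T → V) (c ℓ B : Λ → T → V)
    (h1 : ∀ u, E2 u c = 0)
    (h2 : ∀ u v, E3 u v c - E2 u (fun ν y => br (lam y) (v ν y) - (2 : ℝ)⁻¹ • br (v ν y) (c ν y))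
      - E2 v (fun ν y => br (lam y) (u ν y) - (2 : ℝ)⁻¹ • br (u ν y) (c ν y)) = 0) :
    E3 B B B = (3 : ℝ) • E2 ℓ (fun ν y => br (lam y) (c ν y))
      + ((2 : ℝ) • E2 (B - c - ℓ) (fun ν y => br (lam y) (c ν y))
        + (2 : ℝ) • E2 (B - c) (fun ν y => br (lam y) ((B - c) ν y) - (2 : ℝ)⁻¹ • br ((B - c) ν y) (c ν y))
        + E3 B B (B - c - ℓ)
        + E3 ℓ B (B - c)
        + E2 ℓ (fun ν y => br (lam y) ((B - c) ν y) - (2 : ℝ)⁻¹ • br ((B - c) ν y) (c ν y))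
        + E2 (B - c) (fun ν y => br (lam y) (ℓ ν y) - (2 : ℝ)⁻¹ • br (ℓ ν y) (c ν y))) := by
  have hκ := kappa_split br hself lam c B
  -- last slot `B = c + (B − c)`
  have S1 : E3 B B B = E3 B B c + E3 B B (B - c) := by rw [← map_add]; congr 1; abel
  -- (I.4.15)₂ at `(B, B)`
  have W1 := h2 B B
  have K1 : E2 B (fun ν y => br (lam y) (B ν y) - (2 : ℝ)⁻¹ • br (B ν y) (c ν y))
      = E2 B (fun ν y => br (lam y) (c ν y))
        + E2 B (fun ν y => br (lam y) ((B - c) ν y) - (2 : ℝ)⁻¹ • br ((B - c) ν y) (c ν y)) := by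
    rw [hκ, map_add]
  have S2 : E2 B (fun ν y => br (lam y) (c ν y))
      = E2 c (fun ν y => br (lam y) (c ν y)) + E2 (B - c) (fun ν y => br (lam y) (c ν y)) := by
    rw [← add_apply, ← map_add]; congr 2; abel
  have Z1 : E2 c (fun ν y => br (lam y) (c ν y)) = 0 := by rw [hs2]; exact h1 _
  have S3 : E2 (B - c) (fun ν y => br (lam y) (c ν y))
      = E2 ℓ (fun ν y => br (lam y) (c ν y)) + E2 (B - c - ℓ) (fun ν y => br (lam y) (c ν y)) := by
    rw [← add_apply, ← map_add]; congr 2; abel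
  have S4 : E2 B (fun ν y => br (lam y) ((B - c) ν y) - (2 : ℝ)⁻¹ • br ((B - c) ν y) (c ν y))
      = E2 c (fun ν y => br (lam y) ((B - c) ν y) - (2 : ℝ)⁻¹ • br ((B - c) ν y) (c ν y))
        + E2 (B - c) (fun ν y => br (lam y) ((B - c) ν y) - (2 : ℝ)⁻¹ • br ((B - c) ν y) (c ν y)) := by
    rw [← add_apply, ← map_add]; congr 2; abel
  have Z2 : E2 c (fun ν y => br (lam y) ((B - c) ν y) - (2 : ℝ)⁻¹ • br ((B - c) ν y) (c ν y)) = 0 := by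
    rw [hs2]; exact h1 _
  -- the remaining slot `B − c = ℓ + (B − c − ℓ)`, and `E3 B B ℓ = E3 ℓ B B`
  have S5 : E3 B B (B - c) = E3 B B ℓ + E3 B B (B - c - ℓ) := by rw [← map_add]; congr 1; abel
  have Y1 : E3 B B ℓ = E3 ℓ B B := by rw [hs3r B B ℓ, hs3l B ℓ B]
  have S6 : E3 ℓ B B = E3 ℓ B c + E3 ℓ B (B - c) := by rw [← map_add]; congr 1; abel
  -- (I.4.15)₂ at `(ℓ, B)`
  have W2 := h2 ℓ B
  have K2 : E2 ℓ (fun ν y => br (lam y) (B ν y) - (2 : ℝ)⁻¹ • br (B ν y) (c ν y))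
      = E2 ℓ (fun ν y => br (lam y) (c ν y))
        + E2 ℓ (fun ν y => br (lam y) ((B - c) ν y) - (2 : ℝ)⁻¹ • br ((B - c) ν y) (c ν y)) := by
    rw [hκ, map_add]
  have S7 : E2 B (fun ν y => br (lam y) (ℓ ν y) - (2 : ℝ)⁻¹ • br (ℓ ν y) (c ν y))
      = E2 c (fun ν y => br (lam y) (ℓ ν y) - (2 : ℝ)⁻¹ • br (ℓ ν y) (c ν y))
        + E2 (B - c) (fun ν y => br (lam y) (ℓ ν y) - (2 : ℝ)⁻¹ • br (ℓ ν y) (c ν y)) := by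
    rw [← add_apply, ← map_add]; congr 2; abel
  have Z3 : E2 c (fun ν y => br (lam y) (ℓ ν y) - (2 : ℝ)⁻¹ • br (ℓ ν y) (c ν y)) = 0 := by
    rw [hs2]; exact h1 _
  linear_combination (norm := module) S1 + W1 + (2 : ℝ) • K1 + (2 : ℝ) • S2 + (2 : ℝ) • Z1 + (2 : ℝ) • S3
    + (2 : ℝ) • S4 + (2 : ℝ) • Z2 + S5 + Y1 + S6 + W2 + K2 + S7 + Z3


-- (the quadruply nested operator space over the iterated `Pi` type: one more level of pending instance synthesis)
set_option maxSynthPendingDepth 3 in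
/-- **The `n = 4` term of (3.49)**: with `m = i[λ_z, B(z)]`, `κ(u) = i[λ_z, u] − ½ i[u, ∂λ_z]`,
`⟨E4, B, B, B, B⟩ = 3⟨E2, m, m⟩ + (3⟨E2, m, κ(B − c)⟩ + 3⟨E2, B − c, κ(m)⟩ + 3⟨E3, m, B, B − c⟩ + 3⟨E3, B, B, κ(B − c)⟩
  − ½⟨E2, B, i[B, i[B − c, B(z)]]⟩ + ⟨E4, B, B, B, B − c⟩)` EXACTLY — the last slot `B = c + (B − c)`, (I.4.15)₃ at
`B₁ = B₂ = B₃ = B` (its `k₂{iad,iad}∂λ` terms rewritten by `k2_term_eq`), `κ(B) = m + κ(B − c)`, `⟨E3, B, B, m⟩ =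
⟨E3, m, B, B⟩`, (I.4.15)₂ at `(m, B)`, (I.4.15)₁.  The bracketed terms are print's irrelevant terms of this order.
[cite: Balaban1988Convergent, (3.49) p.280; Balaban1987RG1, (4.15) p.284, (4.21)-(4.29) pp.285-288] -/
theorem term4_eq (E2 : (Λ → T → V) →L[ℝ] (Λ → T → V) →L[ℝ] F)
    (E3 : (Λ → T → V) →L[ℝ] (Λ → T → V) →L[ℝ] (Λ → T → V) →L[ℝ] F)
    (E4 : (Λ → T → V) →L[ℝ] (Λ → T → V) →L[ℝ] (Λ → T → V) →L[ℝ] (Λ → T → V) →L[ℝ] F)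
    (hs2 : ∀ u v, E2 u v = E2 v u) (hs3l : ∀ u v w, E3 u v w = E3 v u w) (hs3r : ∀ u v w, E3 u v w = E3 u w v)
    (br : V →ₗ[ℝ] V →ₗ[ℝ] V) (hself : ∀ a, br a a = 0) (lam : T → V) (c B : Λ → T → V)
    (h1 : ∀ u, E2 u c = 0)
    (h2 : ∀ u v, E3 u v c - E2 u (fun ν y => br (lam y) (v ν y) - (2 : ℝ)⁻¹ • br (v ν y) (c ν y))
      - E2 v (fun ν y => br (lam y) (u ν y) - (2 : ℝ)⁻¹ • br (u ν y) (c ν y)) = 0)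
    (h3 : ∀ u₁ u₂ u₃, E4 u₁ u₂ u₃ c
      - E3 u₁ u₂ (fun ν y => br (lam y) (u₃ ν y) - (2 : ℝ)⁻¹ • br (u₃ ν y) (c ν y))
      - E3 u₁ u₃ (fun ν y => br (lam y) (u₂ ν y) - (2 : ℝ)⁻¹ • br (u₂ ν y) (c ν y))
      - E3 u₂ u₃ (fun ν y => br (lam y) (u₁ ν y) - (2 : ℝ)⁻¹ • br (u₁ ν y) (c ν y))
      + E2 u₁ (fun ν y => (12 : ℝ)⁻¹ • (br (u₂ ν y) (br (u₃ ν y) (c ν y)) + br (u₃ ν y) (br (u₂ ν y) (c ν y))))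
      + E2 u₂ (fun ν y => (12 : ℝ)⁻¹ • (br (u₁ ν y) (br (u₃ ν y) (c ν y)) + br (u₃ ν y) (br (u₁ ν y) (c ν y))))
      + E2 u₃ (fun ν y => (12 : ℝ)⁻¹ • (br (u₁ ν y) (br (u₂ ν y) (c ν y)) + br (u₂ ν y) (br (u₁ ν y) (c ν y))))
      = 0) :
    E4 B B B B = (3 : ℝ) • E2 (fun ν y => br (lam y) (c ν y)) (fun ν y => br (lam y) (c ν y))
      + ((3 : ℝ) • E2 (fun ν y => br (lam y) (c ν y))
            (fun ν y => br (lam y) ((B - c) ν y) - (2 : ℝ)⁻¹ • br ((B - c) ν y) (c ν y))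
        + (3 : ℝ) • E2 (B - c)
            (fun ν y => br (lam y) (br (lam y) (c ν y)) - (2 : ℝ)⁻¹ • br (br (lam y) (c ν y)) (c ν y))
        + (3 : ℝ) • E3 (fun ν y => br (lam y) (c ν y)) B (B - c)
        + (3 : ℝ) • E3 B B (fun ν y => br (lam y) ((B - c) ν y) - (2 : ℝ)⁻¹ • br ((B - c) ν y) (c ν y))
        - (2 : ℝ)⁻¹ • E2 B (fun ν y => br (B ν y) (br ((B - c) ν y) (c ν y)))
        + E4 B B B (B - c)) := by
  have hκ := kappa_split br hself lam c B
  -- last slot `B = c + (B − c)`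
  have S1 : E4 B B B B = E4 B B B c + E4 B B B (B - c) := by rw [← map_add]; congr 1; abel
  -- (I.4.15)₃ at `B₁ = B₂ = B₃ = B`
  have W := h3 B B B
  -- its `k₂` terms: `i[B, ∂λ_z] = i[B − B(z), B(z)]`
  have Q : E2 B (fun ν y => (12 : ℝ)⁻¹ • (br (B ν y) (br (B ν y) (c ν y)) + br (B ν y) (br (B ν y) (c ν y))))
      = (6 : ℝ)⁻¹ • E2 B (fun ν y => br (B ν y) (br ((B - c) ν y) (c ν y))) := by
    rw [k2_term_eq br hself c B, map_smul]
  have K1 : E3 B B (fun ν y => br (lam y) (B ν y) - (2 : ℝ)⁻¹ • br (B ν y) (c ν y))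
      = E3 B B (fun ν y => br (lam y) (c ν y))
        + E3 B B (fun ν y => br (lam y) ((B - c) ν y) - (2 : ℝ)⁻¹ • br ((B - c) ν y) (c ν y)) := by
    rw [hκ, map_add]
  have Y1 : E3 B B (fun ν y => br (lam y) (c ν y)) = E3 (fun ν y => br (lam y) (c ν y)) B B := by
    rw [hs3r B B, hs3l B _ B]
  have S2 : E3 (fun ν y => br (lam y) (c ν y)) B B
      = E3 (fun ν y => br (lam y) (c ν y)) B c + E3 (fun ν y => br (lam y) (c ν y)) B (B - c) := by
    rw [← map_add]; congr 1; abel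
  -- (I.4.15)₂ at `(m, B)`
  have W2 := h2 (fun ν y => br (lam y) (c ν y)) B
  have K2 : E2 (fun ν y => br (lam y) (c ν y)) (fun ν y => br (lam y) (B ν y) - (2 : ℝ)⁻¹ • br (B ν y) (c ν y))
      = E2 (fun ν y => br (lam y) (c ν y)) (fun ν y => br (lam y) (c ν y))
        + E2 (fun ν y => br (lam y) (c ν y))
            (fun ν y => br (lam y) ((B - c) ν y) - (2 : ℝ)⁻¹ • br ((B - c) ν y) (c ν y)) := by
    rw [hκ, map_add]
  have S3 : E2 B (fun ν y => br (lam y) (br (lam y) (c ν y)) - (2 : ℝ)⁻¹ • br (br (lam y) (c ν y)) (c ν y))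
      = E2 c (fun ν y => br (lam y) (br (lam y) (c ν y)) - (2 : ℝ)⁻¹ • br (br (lam y) (c ν y)) (c ν y))
        + E2 (B - c)
            (fun ν y => br (lam y) (br (lam y) (c ν y)) - (2 : ℝ)⁻¹ • br (br (lam y) (c ν y)) (c ν y)) := by
    rw [← add_apply, ← map_add]; congr 2; abel
  have Z : E2 c (fun ν y => br (lam y) (br (lam y) (c ν y)) - (2 : ℝ)⁻¹ • br (br (lam y) (c ν y)) (c ν y))
      = 0 := by
    rw [hs2]; exact h1 _
  linear_combination (norm := module) S1 + W - (3 : ℝ) • Q + (3 : ℝ) • K1 + (3 : ℝ) • Y1 + (3 : ℝ) • S2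
    + (3 : ℝ) • W2 + (3 : ℝ) • K2 + (3 : ℝ) • S3 + (3 : ℝ) • Z

-- (the quadruply nested operator space over the iterated `Pi` type: one more level of pending instance synthesis)
set_option maxSynthPendingDepth 3 in
/-- **(3.49) p. 280 as an EXACT identity for abstract towers** — *"applying the Ward-Takahashi identities (I.4.14),
(I.4.15), and other operations of that section, we move the factors B to the point z instead of the point x"*: under
(I.4.14) `E1 = 0` (`h14`) and (I.4.15)₁,₂,₃ at `B = 0` (`h1`, `h2`, `h3`, with `∂λ_z ↦ c`), for every decomposition
`B = c + ℓ + (B − c − ℓ)` of the field (`c` = «B at the point z», `ℓ` = its linear Taylor term at `z`),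
  `Σ_{n=1}^{4} (1/n!)⟨E^{(n)}, ⊗ⁿB⟩ = ½⟨E2, ℓ + ½ i[λ_z, B(z)], ℓ + ½ i[λ_z, B(z)]⟩ + (R₁ + ⋯ + R₁₄)`,
the main term being print's `Σ_{μνκλ}[Σ_{x,y} 𝐄^{(2)}_{μν}(X,x,y,z)(x_κ−z_κ)(y_λ−z_λ)] · ½ tr((∂_κB_μ)(z) + ½i[B_κ(z),B_μ(z)])
((∂_λB_ν)(z) + ½i[B_λ(z),B_ν(z)])` once `⟨E2, u, v⟩ = Σ 𝐄^{(2)}_{μν}(x,y) tr u_μ(x)v_ν(y)`, `ℓ_μ(x) = Σ_κ(x_κ−z_κ)(∂_κB_μ)(z)`,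
`λ_z(x) = Σ_κ(x_κ−z_κ)B_κ(z)` (so that `i[λ_z, B(z)]_μ(x) = Σ_κ(x_κ−z_κ) i[B_κ(z), B_μ(z)]`; §5), and the fourteen
terms `R₁, …, R₁₄` — print's «(the irrelevant terms)», here EXPLICIT, in this order — being
`⟨E2, ℓ, r⟩`, `½⟨E2, r, r⟩` (n = 2), `⅓⟨E2, r, m⟩`, `⅓⟨E2, B−c, κ(B−c)⟩`, `⅙⟨E3, B, B, r⟩`, `⅙⟨E3, ℓ, B, B−c⟩`,
`⅙⟨E2, ℓ, κ(B−c)⟩`, `⅙⟨E2, B−c, κ(ℓ)⟩` (n = 3), `⅛⟨E2, m, κ(B−c)⟩`, `⅛⟨E2, B−c, κ(m)⟩`, `⅛⟨E3, m, B, B−c⟩`,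
`⅛⟨E3, B, B, κ(B−c)⟩`, `−(1/48)⟨E2, B, i[B, i[B−c, c]]⟩`, `(1/24)⟨E4, B, B, B, B−c⟩` (n = 4), where `r = B − c − ℓ`,
`m = i[λ_z, c]`, `κ(u) = i[λ_z, u] − ½ i[u, c]`: each carries the Taylor remainder `r` or has total `B`-dimension ≥ 5
(their size is `remainder349_norm_le`, §3).  Assembled from `term2_eq`, `term3_eq`, `term4_eq` by one linear
combination. [cite: Balaban1988Convergent, (3.49) p.280, p.281; Balaban1987RG1, (4.14)-(4.15) p.284, (4.34) p.289] -/
theorem eq349_abstract (E1 : (Λ → T → V) →L[ℝ] F) (E2 : (Λ → T → V) →L[ℝ] (Λ → T → V) →L[ℝ] F)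
    (E3 : (Λ → T → V) →L[ℝ] (Λ → T → V) →L[ℝ] (Λ → T → V) →L[ℝ] F)
    (E4 : (Λ → T → V) →L[ℝ] (Λ → T → V) →L[ℝ] (Λ → T → V) →L[ℝ] (Λ → T → V) →L[ℝ] F)
    (hs2 : ∀ u v, E2 u v = E2 v u) (hs3l : ∀ u v w, E3 u v w = E3 v u w) (hs3r : ∀ u v w, E3 u v w = E3 u w v)
    (br : V →ₗ[ℝ] V →ₗ[ℝ] V) (hself : ∀ a, br a a = 0) (lam : T → V) (c ℓ B : Λ → T → V)
    (h14 : ∀ u, E1 u = 0) (h1 : ∀ u, E2 u c = 0)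
    (h2 : ∀ u v, E3 u v c - E2 u (fun ν y => br (lam y) (v ν y) - (2 : ℝ)⁻¹ • br (v ν y) (c ν y))
      - E2 v (fun ν y => br (lam y) (u ν y) - (2 : ℝ)⁻¹ • br (u ν y) (c ν y)) = 0)
    (h3 : ∀ u₁ u₂ u₃, E4 u₁ u₂ u₃ c
      - E3 u₁ u₂ (fun ν y => br (lam y) (u₃ ν y) - (2 : ℝ)⁻¹ • br (u₃ ν y) (c ν y))
      - E3 u₁ u₃ (fun ν y => br (lam y) (u₂ ν y) - (2 : ℝ)⁻¹ • br (u₂ ν y) (c ν y))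
      - E3 u₂ u₃ (fun ν y => br (lam y) (u₁ ν y) - (2 : ℝ)⁻¹ • br (u₁ ν y) (c ν y))
      + E2 u₁ (fun ν y => (12 : ℝ)⁻¹ • (br (u₂ ν y) (br (u₃ ν y) (c ν y)) + br (u₃ ν y) (br (u₂ ν y) (c ν y))))
      + E2 u₂ (fun ν y => (12 : ℝ)⁻¹ • (br (u₁ ν y) (br (u₃ ν y) (c ν y)) + br (u₃ ν y) (br (u₁ ν y) (c ν y))))
      + E2 u₃ (fun ν y => (12 : ℝ)⁻¹ • (br (u₁ ν y) (br (u₂ ν y) (c ν y)) + br (u₂ ν y) (br (u₁ ν y) (c ν y))))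
      = 0) :
    E1 B + (2 : ℝ)⁻¹ • E2 B B + (6 : ℝ)⁻¹ • E3 B B B + (24 : ℝ)⁻¹ • E4 B B B B =
      (2 : ℝ)⁻¹ • E2 (ℓ + (2 : ℝ)⁻¹ • fun ν y => br (lam y) (c ν y)) (ℓ + (2 : ℝ)⁻¹ • fun ν y => br (lam y) (c ν y))
      + (E2 ℓ (B - c - ℓ) + (2 : ℝ)⁻¹ • E2 (B - c - ℓ) (B - c - ℓ)
        + (3 : ℝ)⁻¹ • E2 (B - c - ℓ) (fun ν y => br (lam y) (c ν y))
        + (3 : ℝ)⁻¹ • E2 (B - c) (fun ν y => br (lam y) ((B - c) ν y) - (2 : ℝ)⁻¹ • br ((B - c) ν y) (c ν y))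
        + (6 : ℝ)⁻¹ • E3 B B (B - c - ℓ)
        + (6 : ℝ)⁻¹ • E3 ℓ B (B - c)
        + (6 : ℝ)⁻¹ • E2 ℓ (fun ν y => br (lam y) ((B - c) ν y) - (2 : ℝ)⁻¹ • br ((B - c) ν y) (c ν y))
        + (6 : ℝ)⁻¹ • E2 (B - c) (fun ν y => br (lam y) (ℓ ν y) - (2 : ℝ)⁻¹ • br (ℓ ν y) (c ν y))
        + (8 : ℝ)⁻¹ • E2 (fun ν y => br (lam y) (c ν y))
            (fun ν y => br (lam y) ((B - c) ν y) - (2 : ℝ)⁻¹ • br ((B - c) ν y) (c ν y))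
        + (8 : ℝ)⁻¹ • E2 (B - c)
            (fun ν y => br (lam y) (br (lam y) (c ν y)) - (2 : ℝ)⁻¹ • br (br (lam y) (c ν y)) (c ν y))
        + (8 : ℝ)⁻¹ • E3 (fun ν y => br (lam y) (c ν y)) B (B - c)
        + (8 : ℝ)⁻¹ • E3 B B (fun ν y => br (lam y) ((B - c) ν y) - (2 : ℝ)⁻¹ • br ((B - c) ν y) (c ν y))
        - (48 : ℝ)⁻¹ • E2 B (fun ν y => br (B ν y) (br ((B - c) ν y) (c ν y)))
        + (24 : ℝ)⁻¹ • E4 B B B (B - c)) := by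
  have Z := h14 B
  have T2 := term2_eq E2 hs2 c ℓ B h1
  have T3 := term3_eq E2 E3 hs2 hs3l hs3r br hself lam c ℓ B h1 h2
  have T4 := term4_eq E2 E3 E4 hs2 hs3l hs3r br hself lam c B h1 h2 h3
  have M : E2 (ℓ + (2 : ℝ)⁻¹ • fun ν y => br (lam y) (c ν y)) (ℓ + (2 : ℝ)⁻¹ • fun ν y => br (lam y) (c ν y))
      = E2 ℓ ℓ + (2 : ℝ)⁻¹ • E2 ℓ (fun ν y => br (lam y) (c ν y))
        + (2 : ℝ)⁻¹ • E2 (fun ν y => br (lam y) (c ν y)) ℓ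
        + (2 : ℝ)⁻¹ • ((2 : ℝ)⁻¹ • E2 (fun ν y => br (lam y) (c ν y)) (fun ν y => br (lam y) (c ν y))) := by
    simp only [map_add, map_smul, add_apply, FunLike.coe_smul, Pi.smul_apply, smul_add]
    abel
  have Y := hs2 (fun ν y => br (lam y) (c ν y)) ℓ
  linear_combination (norm := module) Z + (2 : ℝ)⁻¹ • T2 + (6 : ℝ)⁻¹ • T3 + (24 : ℝ)⁻¹ • T4
    - (2 : ℝ)⁻¹ • M - (4 : ℝ)⁻¹ • Y

end Abstract

/-! ## §3. Power counting: the fourteen remainder terms are `O(σ⁴τ)`, `σ = LʲL⁻ⁿ`, `τ = σ^β`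

p. 281: *"Let us recall that (the irrelevant terms) above, and in (3.49), denotes the sum of terms which can be bounded
by O((LʲL⁻ⁿ)^{5−β}) exp(−κd_j(X)), where β is a positive number."*  Here: on FINITE index types (so that the bond
fields carry the sup norm), if the towers are bounded (`‖E2 u v‖ ≤ e₂‖u‖‖v‖`, …; for Bałaban's `𝐄^{(n)}(X, z)` the
Cauchy bounds give `e_n = O(1) n! E₀ exp(−κd_j(X))`, cf. (3.48) and (I.1.18) = [I] (1.18) p. 263; v1–v1.1 wrote «(II.1.18)», a slip), the bracket is bounded
(`‖i[x,y]‖ ≤ b‖x‖‖y‖`), and the pieces of the field obey the scaling of (I.4.16)–(I.4.18) read «in the L⁻ⁿ-scale»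
(p. 280): `‖B(z)‖ ≤ aσ`, `‖λ_z‖ ≤ aσ`, `‖B(·,z)‖ ≤ aσ²`, `‖B − B(z) − B(·,z)‖ ≤ aσ²τ` with `0 ≤ σ ≤ τ ≤ 1`
(`τ = σ^β`, `0 < β ≤ 1`; the window diameter is absorbed in `a`), then `‖R₁ + ⋯ + R₁₄‖ ≤ K(e, a, b)·σ⁴τ` with an
explicit polynomial `K` — total `B`-dimension ≥ 5 or one Taylor remainder: `σ⁵ ≤ σ⁴τ = σ^{4+β} = σ^{5−(1−β)}`. -/

section Bound

variable {Λ T : Type*} [Fintype Λ] [Fintype T] {V : Type*} [NormedAddCommGroup V] [NormedSpace ℝ V]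
  {F : Type*} [NormedAddCommGroup F] [NormedSpace ℝ F]

omit [NormedSpace ℝ V] in
/-- A component of a bond field is bounded by the field's sup norm. [folklore] -/
private theorem norm_apply_apply_le (u : Λ → T → V) (ν : Λ) (y : T) : ‖u ν y‖ ≤ ‖u‖ :=
  (norm_le_pi_norm (u ν) y).trans (norm_le_pi_norm u ν)

omit [NormedSpace ℝ V] in
/-- The sup norm of a bond field is bounded by a uniform bound of its components. [folklore] -/
private theorem pi2_norm_le {g : Λ → T → V} {M : ℝ} (hM : 0 ≤ M) (h : ∀ ν y, ‖g ν y‖ ≤ M) : ‖g‖ ≤ M :=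
  (pi_norm_le_iff_of_nonneg hM).2 fun ν => (pi_norm_le_iff_of_nonneg hM).2 fun y => h ν y

/-- `‖(i[p(y), u_ν(y)])_{ν,y}‖ ≤ b‖p‖‖u‖` for a bracket with `‖i[x, y]‖ ≤ b‖x‖‖y‖` (sup norms). [folklore] -/
private theorem norm_brField_left_le (br : V →ₗ[ℝ] V →ₗ[ℝ] V) {b : ℝ} (hb0 : 0 ≤ b)
    (hb : ∀ x y : V, ‖br x y‖ ≤ b * ‖x‖ * ‖y‖) (p : T → V) (u : Λ → T → V) :
    ‖(fun ν y => br (p y) (u ν y))‖ ≤ b * ‖p‖ * ‖u‖ := by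
  refine pi2_norm_le (mul_nonneg (mul_nonneg hb0 (norm_nonneg _)) (norm_nonneg _)) fun ν y => (hb _ _).trans ?_
  exact mul_le_mul (mul_le_mul_of_nonneg_left (norm_le_pi_norm p y) hb0) (norm_apply_apply_le u ν y)
    (norm_nonneg _) (mul_nonneg hb0 (norm_nonneg _))

/-- `‖(i[u_ν(y), v_ν(y)])_{ν,y}‖ ≤ b‖u‖‖v‖`. [folklore] -/
private theorem norm_brField_le (br : V →ₗ[ℝ] V →ₗ[ℝ] V) {b : ℝ} (hb0 : 0 ≤ b)
    (hb : ∀ x y : V, ‖br x y‖ ≤ b * ‖x‖ * ‖y‖) (u v : Λ → T → V) :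
    ‖(fun ν y => br (u ν y) (v ν y))‖ ≤ b * ‖u‖ * ‖v‖ := by
  refine pi2_norm_le (mul_nonneg (mul_nonneg hb0 (norm_nonneg _)) (norm_nonneg _)) fun ν y => (hb _ _).trans ?_
  exact mul_le_mul (mul_le_mul_of_nonneg_left (norm_apply_apply_le u ν y) hb0) (norm_apply_apply_le v ν y)
    (norm_nonneg _) (mul_nonneg hb0 (norm_nonneg _))

/-- The variation `κ(u) = i[λ_z, u] − ½ i[u, ∂λ_z]` of (I.4.15)₂,₃ in sup norms: `‖κ(u)‖ ≤ b‖λ_z‖‖u‖ + ½ b‖u‖‖c‖`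
(bracket bounded by `b`). [cite: Balaban1987RG1, (4.15) p.284; Balaban1988Convergent, p.281] -/
theorem norm_kappa_le (br : V →ₗ[ℝ] V →ₗ[ℝ] V) {b : ℝ} (hb0 : 0 ≤ b)
    (hb : ∀ x y : V, ‖br x y‖ ≤ b * ‖x‖ * ‖y‖) (p : T → V) (c u : Λ → T → V) :
    ‖(fun ν y => br (p y) (u ν y) - (2 : ℝ)⁻¹ • br (u ν y) (c ν y))‖
      ≤ b * ‖p‖ * ‖u‖ + (2 : ℝ)⁻¹ * (b * ‖u‖ * ‖c‖) := by
  have h : (fun ν y => br (p y) (u ν y) - (2 : ℝ)⁻¹ • br (u ν y) (c ν y))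
      = (fun ν y => br (p y) (u ν y)) - (2 : ℝ)⁻¹ • (fun ν y => br (u ν y) (c ν y)) := by
    funext ν y; rfl
  rw [h]
  refine (norm_sub_le _ _).trans (add_le_add (norm_brField_left_le br hb0 hb p u) ?_)
  rw [norm_smul, norm_inv, Real.norm_ofNat]
  exact mul_le_mul_of_nonneg_left (norm_brField_le br hb0 hb u c) (by norm_num)

/-- Monotonicity of a product of nonnegative bounds (three factors). [folklore] -/
private theorem le_mul3 {t e x y X Y : ℝ} (ht : t ≤ e * x * y) (he : 0 ≤ e) (hx : 0 ≤ x) (hy : 0 ≤ y)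
    (hX : x ≤ X) (hY : y ≤ Y) : t ≤ e * X * Y :=
  ht.trans (mul_le_mul (mul_le_mul_of_nonneg_left hX he) hY hy (mul_nonneg he (hx.trans hX)))

/-- Monotonicity of a product of nonnegative bounds (four factors). [folklore] -/
private theorem le_mul4 {t e x y w X Y W : ℝ} (ht : t ≤ e * x * y * w) (he : 0 ≤ e) (hx : 0 ≤ x) (hy : 0 ≤ y)
    (hw : 0 ≤ w) (hX : x ≤ X) (hY : y ≤ Y) (hW : w ≤ W) : t ≤ e * X * Y * W :=
  ht.trans (mul_le_mul (le_mul3 le_rfl he hx hy hX hY) hW hw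
    (mul_nonneg (mul_nonneg he (hx.trans hX)) (hy.trans hY)))

/-- Monotonicity of a product of nonnegative bounds (five factors). [folklore] -/
private theorem le_mul5 {t e x y w v X Y W U : ℝ} (ht : t ≤ e * x * y * w * v) (he : 0 ≤ e) (hx : 0 ≤ x)
    (hy : 0 ≤ y) (hw : 0 ≤ w) (hv : 0 ≤ v) (hX : x ≤ X) (hY : y ≤ Y) (hW : w ≤ W) (hU : v ≤ U) :
    t ≤ e * X * Y * W * U :=
  ht.trans (mul_le_mul (le_mul4 le_rfl he hx hy hw hX hY hW) hU hv
    (mul_nonneg (mul_nonneg (mul_nonneg he (hx.trans hX)) (hy.trans hY)) (hw.trans hW)))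

/-- `B`-dimension 5 is irrelevant: `Pσ⁵ ≤ Pσ⁴τ` for `0 ≤ σ ≤ τ`. [folklore] -/
private theorem step5 {P σ τ : ℝ} (hP : 0 ≤ P) (hσ0 : 0 ≤ σ) (hστ : σ ≤ τ) : P * σ ^ 5 ≤ P * (σ ^ 4 * τ) := by
  calc P * σ ^ 5 = (P * σ ^ 4) * σ := by ring
    _ ≤ (P * σ ^ 4) * τ := mul_le_mul_of_nonneg_left hστ (mul_nonneg hP (pow_nonneg hσ0 4))
    _ = P * (σ ^ 4 * τ) := by ring

/-- Two Taylor remainders: `Pσ⁴τ·τ ≤ Pσ⁴τ` for `0 ≤ τ ≤ 1`. [folklore] -/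
private theorem stepτ {P σ τ : ℝ} (hP : 0 ≤ P) (hσ0 : 0 ≤ σ) (hτ0 : 0 ≤ τ) (hτ1 : τ ≤ 1) :
    P * (σ ^ 4 * τ) * τ ≤ P * (σ ^ 4 * τ) :=
  mul_le_of_le_one_right (mul_nonneg hP (mul_nonneg (pow_nonneg hσ0 4) hτ0)) hτ1

-- (the quadruply nested operator space over the iterated `Pi` type: one more level of pending instance synthesis)
set_option maxSynthPendingDepth 3 in
/-- **«(the irrelevant terms) … can be bounded by O((LʲL⁻ⁿ)^{5−β})» (p. 281) — the power counting of the fourteen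
remainder terms of `eq349_abstract`.**  On finite index types, for bounded towers (`e₂, e₃, e₄`), a bounded bracket
(`b`) and a field whose pieces scale as on p. 280 / (I.4.16)–(I.4.18) — `‖c‖ ≤ aσ` (`c = B(z)`), `‖λ_z‖ ≤ aσ`,
`‖ℓ‖ ≤ aσ²` (`ℓ = B(·, z)`), `‖B − c − ℓ‖ ≤ aσ²τ` (second-order Taylor remainder), `0 ≤ σ ≤ τ ≤ 1` (`σ = LʲL⁻ⁿ`,
`τ = σ^β`) — the remainder satisfies `‖R₁ + ⋯ + R₁₄‖ ≤ K·σ⁴τ`,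
`K = (3/2)e₂a² + (10/3)e₂a³b + (9/8)e₂a⁴b² + (5/2)e₃a³ + (33/8)e₃a⁴b + (9/4)e₄a⁴`; i.e. `O(σ^{4+β})` against the
marginal `O(σ⁴)` of the main term.  The factor `exp(−κd_j(X))` of print sits inside `e₂, e₃, e₄`.  MODEL NOTE:
print's exponent `5 − β` and (I.4.18)'s `2 + β` are both «a power strictly between the marginal and the next
integer»; here `4 + β = 5 − (1 − β)`. [cite: Balaban1988Convergent, (3.49) p.280, p.281; Balaban1987RG1,
(4.16)-(4.18) p.285, (4.22) p.286] -/
theorem remainder349_norm_le (E2 : (Λ → T → V) →L[ℝ] (Λ → T → V) →L[ℝ] F)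
    (E3 : (Λ → T → V) →L[ℝ] (Λ → T → V) →L[ℝ] (Λ → T → V) →L[ℝ] F)
    (E4 : (Λ → T → V) →L[ℝ] (Λ → T → V) →L[ℝ] (Λ → T → V) →L[ℝ] (Λ → T → V) →L[ℝ] F)
    {e₂ e₃ e₄ : ℝ} (he₂ : 0 ≤ e₂) (he₃ : 0 ≤ e₃) (he₄ : 0 ≤ e₄)
    (hE2 : ∀ u v, ‖E2 u v‖ ≤ e₂ * ‖u‖ * ‖v‖) (hE3 : ∀ u v w, ‖E3 u v w‖ ≤ e₃ * ‖u‖ * ‖v‖ * ‖w‖)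
    (hE4 : ∀ u v w x, ‖E4 u v w x‖ ≤ e₄ * ‖u‖ * ‖v‖ * ‖w‖ * ‖x‖)
    (br : V →ₗ[ℝ] V →ₗ[ℝ] V) {b : ℝ} (hb0 : 0 ≤ b) (hb : ∀ x y : V, ‖br x y‖ ≤ b * ‖x‖ * ‖y‖)
    (lam : T → V) (c ℓ B : Λ → T → V) {a σ τ : ℝ} (ha : 0 ≤ a) (hσ0 : 0 ≤ σ) (hσ1 : σ ≤ 1) (hστ : σ ≤ τ)
    (hτ1 : τ ≤ 1) (hc : ‖c‖ ≤ a * σ) (hlam : ‖lam‖ ≤ a * σ) (hℓ : ‖ℓ‖ ≤ a * σ ^ 2)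
    (hr : ‖B - c - ℓ‖ ≤ a * σ ^ 2 * τ) :
    ‖E2 ℓ (B - c - ℓ) + (2 : ℝ)⁻¹ • E2 (B - c - ℓ) (B - c - ℓ)
        + (3 : ℝ)⁻¹ • E2 (B - c - ℓ) (fun ν y => br (lam y) (c ν y))
        + (3 : ℝ)⁻¹ • E2 (B - c) (fun ν y => br (lam y) ((B - c) ν y) - (2 : ℝ)⁻¹ • br ((B - c) ν y) (c ν y))
        + (6 : ℝ)⁻¹ • E3 B B (B - c - ℓ)
        + (6 : ℝ)⁻¹ • E3 ℓ B (B - c)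
        + (6 : ℝ)⁻¹ • E2 ℓ (fun ν y => br (lam y) ((B - c) ν y) - (2 : ℝ)⁻¹ • br ((B - c) ν y) (c ν y))
        + (6 : ℝ)⁻¹ • E2 (B - c) (fun ν y => br (lam y) (ℓ ν y) - (2 : ℝ)⁻¹ • br (ℓ ν y) (c ν y))
        + (8 : ℝ)⁻¹ • E2 (fun ν y => br (lam y) (c ν y))
            (fun ν y => br (lam y) ((B - c) ν y) - (2 : ℝ)⁻¹ • br ((B - c) ν y) (c ν y))
        + (8 : ℝ)⁻¹ • E2 (B - c)
            (fun ν y => br (lam y) (br (lam y) (c ν y)) - (2 : ℝ)⁻¹ • br (br (lam y) (c ν y)) (c ν y))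
        + (8 : ℝ)⁻¹ • E3 (fun ν y => br (lam y) (c ν y)) B (B - c)
        + (8 : ℝ)⁻¹ • E3 B B (fun ν y => br (lam y) ((B - c) ν y) - (2 : ℝ)⁻¹ • br ((B - c) ν y) (c ν y))
        - (48 : ℝ)⁻¹ • E2 B (fun ν y => br (B ν y) (br ((B - c) ν y) (c ν y)))
        + (24 : ℝ)⁻¹ • E4 B B B (B - c)‖
      ≤ ((3 / 2 : ℝ) * e₂ * a ^ 2 + (10 / 3 : ℝ) * e₂ * a ^ 3 * b + (9 / 8 : ℝ) * e₂ * a ^ 4 * b ^ 2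
          + (5 / 2 : ℝ) * e₃ * a ^ 3 + (33 / 8 : ℝ) * e₃ * a ^ 4 * b + (9 / 4 : ℝ) * e₄ * a ^ 4) * σ ^ 4 * τ := by
  have hτ0 : 0 ≤ τ := hσ0.trans hστ
  have hσ2 : σ ^ 2 ≤ σ := by nlinarith
  -- sizes of the composite fields
  have hw : ‖B - c‖ ≤ 2 * a * σ ^ 2 := by
    have e : B - c = ℓ + (B - c - ℓ) := by abel
    have h1 : a * σ ^ 2 * τ ≤ a * σ ^ 2 := mul_le_of_le_one_right (by positivity) hτ1
    rw [e]; exact (norm_add_le _ _).trans (by linarith)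
  have hB : ‖B‖ ≤ 3 * a * σ := by
    have e : B = c + (B - c) := by abel
    have h1 : a * σ ^ 2 ≤ a * σ := mul_le_mul_of_nonneg_left hσ2 ha
    calc ‖B‖ = ‖c + (B - c)‖ := by rw [← e]
      _ ≤ ‖c‖ + ‖B - c‖ := norm_add_le _ _
      _ ≤ 3 * a * σ := by linarith
  have hm : ‖(fun ν y => br (lam y) (c ν y))‖ ≤ b * (a * σ) * (a * σ) :=
    le_mul3 (norm_brField_left_le br hb0 hb lam c) hb0 (norm_nonneg _) (norm_nonneg _) hlam hc
  have hκw : ‖(fun ν y => br (lam y) ((B - c) ν y) - (2 : ℝ)⁻¹ • br ((B - c) ν y) (c ν y))‖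
      ≤ b * (a * σ) * (2 * a * σ ^ 2) + (2 : ℝ)⁻¹ * (b * (2 * a * σ ^ 2) * (a * σ)) :=
    (norm_kappa_le br hb0 hb lam c (B - c)).trans (add_le_add
      (le_mul3 le_rfl hb0 (norm_nonneg _) (norm_nonneg _) hlam hw)
      (mul_le_mul_of_nonneg_left (le_mul3 le_rfl hb0 (norm_nonneg _) (norm_nonneg _) hw hc) (by norm_num)))
  have hκℓ : ‖(fun ν y => br (lam y) (ℓ ν y) - (2 : ℝ)⁻¹ • br (ℓ ν y) (c ν y))‖
      ≤ b * (a * σ) * (a * σ ^ 2) + (2 : ℝ)⁻¹ * (b * (a * σ ^ 2) * (a * σ)) :=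
    (norm_kappa_le br hb0 hb lam c ℓ).trans (add_le_add
      (le_mul3 le_rfl hb0 (norm_nonneg _) (norm_nonneg _) hlam hℓ)
      (mul_le_mul_of_nonneg_left (le_mul3 le_rfl hb0 (norm_nonneg _) (norm_nonneg _) hℓ hc) (by norm_num)))
  have hκm : ‖(fun ν y => br (lam y) (br (lam y) (c ν y)) - (2 : ℝ)⁻¹ • br (br (lam y) (c ν y)) (c ν y))‖
      ≤ b * (a * σ) * (b * (a * σ) * (a * σ)) + (2 : ℝ)⁻¹ * (b * (b * (a * σ) * (a * σ)) * (a * σ)) :=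
    (norm_kappa_le br hb0 hb lam c (fun ν y => br (lam y) (c ν y))).trans (add_le_add
      (le_mul3 le_rfl hb0 (norm_nonneg _) (norm_nonneg _) hlam hm)
      (mul_le_mul_of_nonneg_left (le_mul3 le_rfl hb0 (norm_nonneg _) (norm_nonneg _) hm hc) (by norm_num)))
  have hX : ‖(fun ν y => br (B ν y) (br ((B - c) ν y) (c ν y)))‖ ≤ b * (3 * a * σ) * (b * (2 * a * σ ^ 2) * (a * σ)) :=
    le_mul3 (norm_brField_le br hb0 hb B (fun ν y => br ((B - c) ν y) (c ν y))) hb0 (norm_nonneg _)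
      (norm_nonneg _) hB (le_mul3 (norm_brField_le br hb0 hb (B - c) c) hb0 (norm_nonneg _) (norm_nonneg _) hw hc)
  -- the fourteen terms
  have r1 : ‖E2 ℓ (B - c - ℓ)‖ ≤ (e₂ * a ^ 2) * (σ ^ 4 * τ) :=
    (le_mul3 (hE2 _ _) he₂ (norm_nonneg _) (norm_nonneg _) hℓ hr).trans (le_of_eq (by ring))
  have r2 : ‖(2 : ℝ)⁻¹ • E2 (B - c - ℓ) (B - c - ℓ)‖ ≤ ((2 : ℝ)⁻¹ * e₂ * a ^ 2) * (σ ^ 4 * τ) := by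
    rw [norm_smul, norm_inv, Real.norm_ofNat]
    calc (2 : ℝ)⁻¹ * ‖E2 (B - c - ℓ) (B - c - ℓ)‖ ≤ (2 : ℝ)⁻¹ * (e₂ * (a * σ ^ 2 * τ) * (a * σ ^ 2 * τ)) :=
          mul_le_mul_of_nonneg_left (le_mul3 (hE2 _ _) he₂ (norm_nonneg _) (norm_nonneg _) hr hr) (by norm_num)
      _ = ((2 : ℝ)⁻¹ * e₂ * a ^ 2) * (σ ^ 4 * τ) * τ := by ring
      _ ≤ ((2 : ℝ)⁻¹ * e₂ * a ^ 2) * (σ ^ 4 * τ) :=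
          stepτ (mul_nonneg (mul_nonneg (by norm_num) he₂) (pow_nonneg ha 2)) hσ0 hτ0 hτ1
  have r3 : ‖(3 : ℝ)⁻¹ • E2 (B - c - ℓ) (fun ν y => br (lam y) (c ν y))‖
      ≤ ((3 : ℝ)⁻¹ * e₂ * a ^ 3 * b) * (σ ^ 4 * τ) := by
    rw [norm_smul, norm_inv, Real.norm_ofNat]
    calc (3 : ℝ)⁻¹ * ‖E2 (B - c - ℓ) (fun ν y => br (lam y) (c ν y))‖
          ≤ (3 : ℝ)⁻¹ * (e₂ * (a * σ ^ 2 * τ) * (b * (a * σ) * (a * σ))) :=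
          mul_le_mul_of_nonneg_left (le_mul3 (hE2 _ _) he₂ (norm_nonneg _) (norm_nonneg _) hr hm) (by norm_num)
      _ = ((3 : ℝ)⁻¹ * e₂ * a ^ 3 * b) * (σ ^ 4 * τ) := by ring
  have r4 : ‖(3 : ℝ)⁻¹ • E2 (B - c)
        (fun ν y => br (lam y) ((B - c) ν y) - (2 : ℝ)⁻¹ • br ((B - c) ν y) (c ν y))‖
      ≤ (2 * e₂ * a ^ 3 * b) * (σ ^ 4 * τ) := by
    rw [norm_smul, norm_inv, Real.norm_ofNat]
    calc (3 : ℝ)⁻¹ * ‖E2 (B - c) (fun ν y => br (lam y) ((B - c) ν y) - (2 : ℝ)⁻¹ • br ((B - c) ν y) (c ν y))‖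
          ≤ (3 : ℝ)⁻¹ * (e₂ * (2 * a * σ ^ 2)
              * (b * (a * σ) * (2 * a * σ ^ 2) + (2 : ℝ)⁻¹ * (b * (2 * a * σ ^ 2) * (a * σ)))) :=
          mul_le_mul_of_nonneg_left (le_mul3 (hE2 _ _) he₂ (norm_nonneg _) (norm_nonneg _) hw hκw) (by norm_num)
      _ = (2 * e₂ * a ^ 3 * b) * σ ^ 5 := by ring
      _ ≤ (2 * e₂ * a ^ 3 * b) * (σ ^ 4 * τ) :=
          step5 (mul_nonneg (mul_nonneg (mul_nonneg (by norm_num) he₂) (pow_nonneg ha 3)) hb0) hσ0 hστ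
  have r5 : ‖(6 : ℝ)⁻¹ • E3 B B (B - c - ℓ)‖ ≤ ((3 / 2 : ℝ) * e₃ * a ^ 3) * (σ ^ 4 * τ) := by
    rw [norm_smul, norm_inv, Real.norm_ofNat]
    calc (6 : ℝ)⁻¹ * ‖E3 B B (B - c - ℓ)‖ ≤ (6 : ℝ)⁻¹ * (e₃ * (3 * a * σ) * (3 * a * σ) * (a * σ ^ 2 * τ)) :=
          mul_le_mul_of_nonneg_left
            (le_mul4 (hE3 _ _ _) he₃ (norm_nonneg _) (norm_nonneg _) (norm_nonneg _) hB hB hr) (by norm_num)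
      _ = ((3 / 2 : ℝ) * e₃ * a ^ 3) * (σ ^ 4 * τ) := by ring
  have r6 : ‖(6 : ℝ)⁻¹ • E3 ℓ B (B - c)‖ ≤ (e₃ * a ^ 3) * (σ ^ 4 * τ) := by
    rw [norm_smul, norm_inv, Real.norm_ofNat]
    calc (6 : ℝ)⁻¹ * ‖E3 ℓ B (B - c)‖ ≤ (6 : ℝ)⁻¹ * (e₃ * (a * σ ^ 2) * (3 * a * σ) * (2 * a * σ ^ 2)) :=
          mul_le_mul_of_nonneg_left
            (le_mul4 (hE3 _ _ _) he₃ (norm_nonneg _) (norm_nonneg _) (norm_nonneg _) hℓ hB hw) (by norm_num)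
      _ = (e₃ * a ^ 3) * σ ^ 5 := by ring
      _ ≤ (e₃ * a ^ 3) * (σ ^ 4 * τ) := step5 (mul_nonneg he₃ (pow_nonneg ha 3)) hσ0 hστ
  have r7 : ‖(6 : ℝ)⁻¹ • E2 ℓ (fun ν y => br (lam y) ((B - c) ν y) - (2 : ℝ)⁻¹ • br ((B - c) ν y) (c ν y))‖
      ≤ ((2 : ℝ)⁻¹ * e₂ * a ^ 3 * b) * (σ ^ 4 * τ) := by
    rw [norm_smul, norm_inv, Real.norm_ofNat]
    calc (6 : ℝ)⁻¹ * ‖E2 ℓ (fun ν y => br (lam y) ((B - c) ν y) - (2 : ℝ)⁻¹ • br ((B - c) ν y) (c ν y))‖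
          ≤ (6 : ℝ)⁻¹ * (e₂ * (a * σ ^ 2)
              * (b * (a * σ) * (2 * a * σ ^ 2) + (2 : ℝ)⁻¹ * (b * (2 * a * σ ^ 2) * (a * σ)))) :=
          mul_le_mul_of_nonneg_left (le_mul3 (hE2 _ _) he₂ (norm_nonneg _) (norm_nonneg _) hℓ hκw) (by norm_num)
      _ = ((2 : ℝ)⁻¹ * e₂ * a ^ 3 * b) * σ ^ 5 := by ring
      _ ≤ ((2 : ℝ)⁻¹ * e₂ * a ^ 3 * b) * (σ ^ 4 * τ) :=
          step5 (mul_nonneg (mul_nonneg (mul_nonneg (by norm_num) he₂) (pow_nonneg ha 3)) hb0) hσ0 hστ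
  have r8 : ‖(6 : ℝ)⁻¹ • E2 (B - c) (fun ν y => br (lam y) (ℓ ν y) - (2 : ℝ)⁻¹ • br (ℓ ν y) (c ν y))‖
      ≤ ((2 : ℝ)⁻¹ * e₂ * a ^ 3 * b) * (σ ^ 4 * τ) := by
    rw [norm_smul, norm_inv, Real.norm_ofNat]
    calc (6 : ℝ)⁻¹ * ‖E2 (B - c) (fun ν y => br (lam y) (ℓ ν y) - (2 : ℝ)⁻¹ • br (ℓ ν y) (c ν y))‖
          ≤ (6 : ℝ)⁻¹ * (e₂ * (2 * a * σ ^ 2)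
              * (b * (a * σ) * (a * σ ^ 2) + (2 : ℝ)⁻¹ * (b * (a * σ ^ 2) * (a * σ)))) :=
          mul_le_mul_of_nonneg_left (le_mul3 (hE2 _ _) he₂ (norm_nonneg _) (norm_nonneg _) hw hκℓ) (by norm_num)
      _ = ((2 : ℝ)⁻¹ * e₂ * a ^ 3 * b) * σ ^ 5 := by ring
      _ ≤ ((2 : ℝ)⁻¹ * e₂ * a ^ 3 * b) * (σ ^ 4 * τ) :=
          step5 (mul_nonneg (mul_nonneg (mul_nonneg (by norm_num) he₂) (pow_nonneg ha 3)) hb0) hσ0 hστ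
  have r9 : ‖(8 : ℝ)⁻¹ • E2 (fun ν y => br (lam y) (c ν y))
        (fun ν y => br (lam y) ((B - c) ν y) - (2 : ℝ)⁻¹ • br ((B - c) ν y) (c ν y))‖
      ≤ ((3 / 8 : ℝ) * e₂ * a ^ 4 * b ^ 2) * (σ ^ 4 * τ) := by
    rw [norm_smul, norm_inv, Real.norm_ofNat]
    calc (8 : ℝ)⁻¹ * ‖E2 (fun ν y => br (lam y) (c ν y))
            (fun ν y => br (lam y) ((B - c) ν y) - (2 : ℝ)⁻¹ • br ((B - c) ν y) (c ν y))‖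
          ≤ (8 : ℝ)⁻¹ * (e₂ * (b * (a * σ) * (a * σ))
              * (b * (a * σ) * (2 * a * σ ^ 2) + (2 : ℝ)⁻¹ * (b * (2 * a * σ ^ 2) * (a * σ)))) :=
          mul_le_mul_of_nonneg_left (le_mul3 (hE2 _ _) he₂ (norm_nonneg _) (norm_nonneg _) hm hκw) (by norm_num)
      _ = ((3 / 8 : ℝ) * e₂ * a ^ 4 * b ^ 2) * σ ^ 5 := by ring
      _ ≤ ((3 / 8 : ℝ) * e₂ * a ^ 4 * b ^ 2) * (σ ^ 4 * τ) :=
          step5 (mul_nonneg (mul_nonneg (mul_nonneg (by norm_num) he₂) (pow_nonneg ha 4)) (pow_nonneg hb0 2))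
            hσ0 hστ
  have r10 : ‖(8 : ℝ)⁻¹ • E2 (B - c)
        (fun ν y => br (lam y) (br (lam y) (c ν y)) - (2 : ℝ)⁻¹ • br (br (lam y) (c ν y)) (c ν y))‖
      ≤ ((3 / 8 : ℝ) * e₂ * a ^ 4 * b ^ 2) * (σ ^ 4 * τ) := by
    rw [norm_smul, norm_inv, Real.norm_ofNat]
    calc (8 : ℝ)⁻¹ * ‖E2 (B - c)
            (fun ν y => br (lam y) (br (lam y) (c ν y)) - (2 : ℝ)⁻¹ • br (br (lam y) (c ν y)) (c ν y))‖
          ≤ (8 : ℝ)⁻¹ * (e₂ * (2 * a * σ ^ 2)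
              * (b * (a * σ) * (b * (a * σ) * (a * σ)) + (2 : ℝ)⁻¹ * (b * (b * (a * σ) * (a * σ)) * (a * σ)))) :=
          mul_le_mul_of_nonneg_left (le_mul3 (hE2 _ _) he₂ (norm_nonneg _) (norm_nonneg _) hw hκm) (by norm_num)
      _ = ((3 / 8 : ℝ) * e₂ * a ^ 4 * b ^ 2) * σ ^ 5 := by ring
      _ ≤ ((3 / 8 : ℝ) * e₂ * a ^ 4 * b ^ 2) * (σ ^ 4 * τ) :=
          step5 (mul_nonneg (mul_nonneg (mul_nonneg (by norm_num) he₂) (pow_nonneg ha 4)) (pow_nonneg hb0 2))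
            hσ0 hστ
  have r11 : ‖(8 : ℝ)⁻¹ • E3 (fun ν y => br (lam y) (c ν y)) B (B - c)‖
      ≤ ((3 / 4 : ℝ) * e₃ * a ^ 4 * b) * (σ ^ 4 * τ) := by
    rw [norm_smul, norm_inv, Real.norm_ofNat]
    calc (8 : ℝ)⁻¹ * ‖E3 (fun ν y => br (lam y) (c ν y)) B (B - c)‖
          ≤ (8 : ℝ)⁻¹ * (e₃ * (b * (a * σ) * (a * σ)) * (3 * a * σ) * (2 * a * σ ^ 2)) :=
          mul_le_mul_of_nonneg_left
            (le_mul4 (hE3 _ _ _) he₃ (norm_nonneg _) (norm_nonneg _) (norm_nonneg _) hm hB hw) (by norm_num)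
      _ = ((3 / 4 : ℝ) * e₃ * a ^ 4 * b) * σ ^ 5 := by ring
      _ ≤ ((3 / 4 : ℝ) * e₃ * a ^ 4 * b) * (σ ^ 4 * τ) :=
          step5 (mul_nonneg (mul_nonneg (mul_nonneg (by norm_num) he₃) (pow_nonneg ha 4)) hb0) hσ0 hστ
  have r12 : ‖(8 : ℝ)⁻¹ • E3 B B
        (fun ν y => br (lam y) ((B - c) ν y) - (2 : ℝ)⁻¹ • br ((B - c) ν y) (c ν y))‖
      ≤ ((27 / 8 : ℝ) * e₃ * a ^ 4 * b) * (σ ^ 4 * τ) := by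
    rw [norm_smul, norm_inv, Real.norm_ofNat]
    calc (8 : ℝ)⁻¹ * ‖E3 B B (fun ν y => br (lam y) ((B - c) ν y) - (2 : ℝ)⁻¹ • br ((B - c) ν y) (c ν y))‖
          ≤ (8 : ℝ)⁻¹ * (e₃ * (3 * a * σ) * (3 * a * σ)
              * (b * (a * σ) * (2 * a * σ ^ 2) + (2 : ℝ)⁻¹ * (b * (2 * a * σ ^ 2) * (a * σ)))) :=
          mul_le_mul_of_nonneg_left
            (le_mul4 (hE3 _ _ _) he₃ (norm_nonneg _) (norm_nonneg _) (norm_nonneg _) hB hB hκw) (by norm_num)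
      _ = ((27 / 8 : ℝ) * e₃ * a ^ 4 * b) * σ ^ 5 := by ring
      _ ≤ ((27 / 8 : ℝ) * e₃ * a ^ 4 * b) * (σ ^ 4 * τ) :=
          step5 (mul_nonneg (mul_nonneg (mul_nonneg (by norm_num) he₃) (pow_nonneg ha 4)) hb0) hσ0 hστ
  have r13 : ‖(48 : ℝ)⁻¹ • E2 B (fun ν y => br (B ν y) (br ((B - c) ν y) (c ν y)))‖
      ≤ ((3 / 8 : ℝ) * e₂ * a ^ 4 * b ^ 2) * (σ ^ 4 * τ) := by
    rw [norm_smul, norm_inv, Real.norm_ofNat]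
    calc (48 : ℝ)⁻¹ * ‖E2 B (fun ν y => br (B ν y) (br ((B - c) ν y) (c ν y)))‖
          ≤ (48 : ℝ)⁻¹ * (e₂ * (3 * a * σ) * (b * (3 * a * σ) * (b * (2 * a * σ ^ 2) * (a * σ)))) :=
          mul_le_mul_of_nonneg_left (le_mul3 (hE2 _ _) he₂ (norm_nonneg _) (norm_nonneg _) hB hX) (by norm_num)
      _ = ((3 / 8 : ℝ) * e₂ * a ^ 4 * b ^ 2) * σ ^ 5 := by ring
      _ ≤ ((3 / 8 : ℝ) * e₂ * a ^ 4 * b ^ 2) * (σ ^ 4 * τ) :=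
          step5 (mul_nonneg (mul_nonneg (mul_nonneg (by norm_num) he₂) (pow_nonneg ha 4)) (pow_nonneg hb0 2))
            hσ0 hστ
  have r14 : ‖(24 : ℝ)⁻¹ • E4 B B B (B - c)‖ ≤ ((9 / 4 : ℝ) * e₄ * a ^ 4) * (σ ^ 4 * τ) := by
    rw [norm_smul, norm_inv, Real.norm_ofNat]
    calc (24 : ℝ)⁻¹ * ‖E4 B B B (B - c)‖
          ≤ (24 : ℝ)⁻¹ * (e₄ * (3 * a * σ) * (3 * a * σ) * (3 * a * σ) * (2 * a * σ ^ 2)) :=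
          mul_le_mul_of_nonneg_left (le_mul5 (hE4 _ _ _ _) he₄ (norm_nonneg _) (norm_nonneg _) (norm_nonneg _)
            (norm_nonneg _) hB hB hB hw) (by norm_num)
      _ = ((9 / 4 : ℝ) * e₄ * a ^ 4) * σ ^ 5 := by ring
      _ ≤ ((9 / 4 : ℝ) * e₄ * a ^ 4) * (σ ^ 4 * τ) :=
          step5 (mul_nonneg (mul_nonneg (by norm_num) he₄) (pow_nonneg ha 4)) hσ0 hστ
  refine (norm_add_le_of_le (norm_sub_le_of_le (norm_add_le_of_le (norm_add_le_of_le (norm_add_le_of_le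
    (norm_add_le_of_le (norm_add_le_of_le (norm_add_le_of_le (norm_add_le_of_le (norm_add_le_of_le
    (norm_add_le_of_le (norm_add_le_of_le (norm_add_le_of_le r1 r2) r3) r4) r5) r6) r7) r8) r9) r10) r11) r12)
    r13) r14).trans (le_of_eq ?_)
  ring

end Bound

/-! ## §4. In the chart `f(B) = 𝐄(exp ρB)` of [I] §4: every hypothesis of `eq349_abstract` discharged by name from
gauge invariance (I.4.7), `C⁴`-smoothness and «The group G is semisimple» -/

/-- `Σ_{n=1}^{4} (1/n!)⟨𝐄^{(n)}, ⊗ⁿB⟩` — print's left-hand side of (3.49) — read with Mathlib's `iteratedFDeriv` on the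
constant tuple `(B, …, B)` IS the curried expression `Df(0)B + ½D²f(0)(B,B) + ⅙D³f(0)(B,B,B) + (1/24)D⁴f(0)(B,B,B,B)`
used below (`iteratedFDeriv_three_apply`, `iteratedFDeriv_four_apply` of gens 22/24).
[cite: Balaban1988Convergent, (3.49) p.280] -/
theorem taylor4_diag_eq {E F : Type*} [NormedAddCommGroup E] [NormedSpace ℝ E] [NormedAddCommGroup F]
    [NormedSpace ℝ F] (f : E → F) (B : E) :
    iteratedFDeriv ℝ 1 f 0 (fun _ => B) + (2 : ℝ)⁻¹ • iteratedFDeriv ℝ 2 f 0 (fun _ => B)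
      + (6 : ℝ)⁻¹ • iteratedFDeriv ℝ 3 f 0 (fun _ => B) + (24 : ℝ)⁻¹ • iteratedFDeriv ℝ 4 f 0 (fun _ => B)
    = fderiv ℝ f 0 B + (2 : ℝ)⁻¹ • fderiv ℝ (fderiv ℝ f) 0 B B
      + (6 : ℝ)⁻¹ • fderiv ℝ (fderiv ℝ (fderiv ℝ f)) 0 B B B
      + (24 : ℝ)⁻¹ • fderiv ℝ (fderiv ℝ (fderiv ℝ (fderiv ℝ f))) 0 B B B B := by
  rw [iteratedFDeriv_one_apply, iteratedFDeriv_two_apply, B12WardSecond415.iteratedFDeriv_three_apply,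
    B12WardThird415.iteratedFDeriv_four_apply]

section Chart

variable {𝔄 : Type*} [NormedRing 𝔄] [NormedAlgebra ℝ 𝔄] [CompleteSpace 𝔄] {Λ T : Type*} [Fintype Λ] [Fintype T]
  [AddCommGroup T] {V : Type*} [NormedAddCommGroup V] [NormedSpace ℝ V] {F : Type*} [NormedAddCommGroup F]
  [NormedSpace ℝ F]

/-- **(I.4.14) in the chart**: `Df(0) = 0` for `f(B) = 𝐄(exp ρB)` when `𝐄` is `C²` at `1`, invariant under constant
gauge transformations near `1`, and `𝔤` (through `ρ`) is spanned by commutators — by name from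
`…B12Semisimple414.fderiv_chart_zero_eq_zero`; so the `n = 1` term `⟨𝐄^{(1)}(X,z), B⟩` of (3.49) vanishes.
[cite: Balaban1987RG1, (4.14) p.284; Balaban1988Convergent, (3.49) p.280] -/
theorem fderiv_chart_apply_eq_zero {ℰ : (Λ → T → 𝔄) → F} (e : Λ → T) (ρ : V →L[ℝ] 𝔄) (hℰ : ContDiffAt ℝ 2 ℰ 1)
    (h47 : ∀ lam : T → V, ∀ᶠ W in 𝓝 (1 : Λ → T → 𝔄), ∀ᶠ t in 𝓝 (0 : ℝ),
      ℰ (fun ν x => exp (t • ρ (lam x)) * W ν x * exp (-(t • ρ (lam (x + e ν))))) = ℰ W)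
    (hspan : Submodule.span ℝ {c : V | ∃ l v : V, ρ c = ρ l * ρ v - ρ v * ρ l} = ⊤) (u : Λ → T → V) :
    fderiv ℝ (fun A : Λ → T → V => ℰ (fun ν y => exp (ρ (A ν y)))) 0 u = 0 := by
  rw [B12Semisimple414.fderiv_chart_zero_eq_zero e ρ hℰ (fun l => h47 fun _ => l) hspan,
    _root_.zero_apply]

-- (the quadruply nested operator space over the iterated `Pi` type: one more level of pending instance synthesis)
set_option maxSynthPendingDepth 3 in
/-- **(3.49) in the chart, from (I.4.7), `C⁴`-smoothness and perfectness** — `eq349_abstract` for `E1, …, E4` the first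
four derivatives at `B = 0` of `f(B) = 𝐄(exp ρB)` (print's `𝐄^{(n)} = (δⁿ/δBⁿ)𝐄^{(j)}(X, U_j(exp iB), z)|_{B=0}` read in
the chart of [I] §4): the slot symmetries from `…B12Schur433.hessian_chart_symm` /
`…B12WardThird415.fderiv_fderiv_fderiv_apply_swap_left/right`, (I.4.14) from `fderiv_chart_apply_eq_zero`,
(I.4.15)₁,₂,₃ from `…B12WTReduction429.wt_chart_of_bracket`; the bracket any `ρ`-compatible alternating bilinear `br`.
For EVERY gauge function `λ_z` with lattice gradient `c = ∂λ_z` (`hc`) and every `ℓ`; print takes `λ_z` affine at `z`,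
`∂λ_z = B(z)` constant (`…B12WTReduction429.eq423_affine` on `ℤ^Λ`; on a finite torus read `c = ∂λ_z` for the given
`λ_z` — the MODEL NOTE of that file applies verbatim), `ℓ = B(·, z)`. [cite: Balaban1988Convergent, (3.49) p.280;
Balaban1987RG1, (4.7) p.282, (4.14)-(4.15) p.284] -/
theorem eq349_chart_of_bracket {ℰ : (Λ → T → 𝔄) → F} (e : Λ → T) (ρ : V →L[ℝ] 𝔄) (hℰ : ContDiffAt ℝ 4 ℰ 1)
    (h47 : ∀ lam : T → V, ∀ᶠ W in 𝓝 (1 : Λ → T → 𝔄), ∀ᶠ t in 𝓝 (0 : ℝ),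
      ℰ (fun ν x => exp (t • ρ (lam x)) * W ν x * exp (-(t • ρ (lam (x + e ν))))) = ℰ W)
    (br : V →ₗ[ℝ] V →ₗ[ℝ] V) (hbr : ∀ a b, ρ (br a b) = ρ a * ρ b - ρ b * ρ a) (hself : ∀ a, br a a = 0)
    (hspan : Submodule.span ℝ {c : V | ∃ l v : V, ρ c = ρ l * ρ v - ρ v * ρ l} = ⊤)
    (lam : T → V) (c ℓ B : Λ → T → V) (hc : ∀ ν y, lam (y + e ν) - lam y = c ν y) :
    fderiv ℝ (fun A : Λ → T → V => ℰ (fun ν y => exp (ρ (A ν y)))) 0 B + (2 : ℝ)⁻¹ • fderiv ℝ (fderiv ℝ (fun A : Λ → T → V => ℰ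
        (fun ν y => exp (ρ (A ν y))))) 0 B B
        + (6 : ℝ)⁻¹ • fderiv ℝ (fderiv ℝ (fderiv ℝ (fun A : Λ → T → V => ℰ (fun ν y => exp (ρ (A ν y)))))) 0 B B B
        + (24 : ℝ)⁻¹ • fderiv ℝ (fderiv ℝ (fderiv ℝ (fderiv ℝ (fun A : Λ → T → V => ℰ (fun ν y => exp (ρ (A ν y))))))) 0 B B B B =
      (2 : ℝ)⁻¹ • fderiv ℝ (fderiv ℝ (fun A : Λ → T → V => ℰ (fun ν y => exp (ρ (A ν y))))) 0
          (ℓ + (2 : ℝ)⁻¹ • fun ν y => br (lam y) (c ν y))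
          (ℓ + (2 : ℝ)⁻¹ • fun ν y => br (lam y) (c ν y))
      + (fderiv ℝ (fderiv ℝ (fun A : Λ → T → V => ℰ (fun ν y => exp (ρ (A ν y))))) 0 ℓ (B - c - ℓ)
        + (2 : ℝ)⁻¹ • fderiv ℝ (fderiv ℝ (fun A : Λ → T → V => ℰ (fun ν y => exp (ρ (A ν y))))) 0 (B - c - ℓ) (B - c - ℓ)
        + (3 : ℝ)⁻¹ • fderiv ℝ (fderiv ℝ (fun A : Λ → T → V => ℰ (fun ν y => exp (ρ (A ν y))))) 0 (B - c - ℓ)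
            (fun ν y => br (lam y) (c ν y))
        + (3 : ℝ)⁻¹ • fderiv ℝ (fderiv ℝ (fun A : Λ → T → V => ℰ (fun ν y => exp (ρ (A ν y))))) 0 (B - c)
            (fun ν y => br (lam y) ((B - c) ν y) - (2 : ℝ)⁻¹ • br ((B - c) ν y) (c ν y))
        + (6 : ℝ)⁻¹ • fderiv ℝ (fderiv ℝ (fderiv ℝ (fun A : Λ → T → V => ℰ (fun ν y => exp (ρ (A ν y)))))) 0 B B (B - c - ℓ)
        + (6 : ℝ)⁻¹ • fderiv ℝ (fderiv ℝ (fderiv ℝ (fun A : Λ → T → V => ℰ (fun ν y => exp (ρ (A ν y)))))) 0 ℓ B (B - c)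
        + (6 : ℝ)⁻¹ • fderiv ℝ (fderiv ℝ (fun A : Λ → T → V => ℰ (fun ν y => exp (ρ (A ν y))))) 0 ℓ
            (fun ν y => br (lam y) ((B - c) ν y) - (2 : ℝ)⁻¹ • br ((B - c) ν y) (c ν y))
        + (6 : ℝ)⁻¹ • fderiv ℝ (fderiv ℝ (fun A : Λ → T → V => ℰ (fun ν y => exp (ρ (A ν y))))) 0 (B - c)
            (fun ν y => br (lam y) (ℓ ν y) - (2 : ℝ)⁻¹ • br (ℓ ν y) (c ν y))
        + (8 : ℝ)⁻¹ • fderiv ℝ (fderiv ℝ (fun A : Λ → T → V => ℰ (fun ν y => exp (ρ (A ν y))))) 0 (fun ν y => br (lam y) (c ν y))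
            (fun ν y => br (lam y) ((B - c) ν y) - (2 : ℝ)⁻¹ • br ((B - c) ν y) (c ν y))
        + (8 : ℝ)⁻¹ • fderiv ℝ (fderiv ℝ (fun A : Λ → T → V => ℰ (fun ν y => exp (ρ (A ν y))))) 0 (B - c)
            (fun ν y => br (lam y) (br (lam y) (c ν y)) - (2 : ℝ)⁻¹ • br (br (lam y) (c ν y)) (c ν y))
        + (8 : ℝ)⁻¹ • fderiv ℝ (fderiv ℝ (fderiv ℝ (fun A : Λ → T → V => ℰ (fun ν y => exp (ρ (A ν y)))))) 0
            (fun ν y => br (lam y) (c ν y)) B (B - c)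
        + (8 : ℝ)⁻¹ • fderiv ℝ (fderiv ℝ (fderiv ℝ (fun A : Λ → T → V => ℰ (fun ν y => exp (ρ (A ν y)))))) 0 B B
            (fun ν y => br (lam y) ((B - c) ν y) - (2 : ℝ)⁻¹ • br ((B - c) ν y) (c ν y))
        - (48 : ℝ)⁻¹ • fderiv ℝ (fderiv ℝ (fun A : Λ → T → V => ℰ (fun ν y => exp (ρ (A ν y))))) 0 B
            (fun ν y => br (B ν y) (br ((B - c) ν y) (c ν y)))
        + (24 : ℝ)⁻¹ • fderiv ℝ (fderiv ℝ (fderiv ℝ (fderiv ℝ (fun A : Λ → T → V => ℰ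
            (fun ν y => exp (ρ (A ν y))))))) 0 B B B (B - c)) := by
  have hf3 := B12WardThird415.contDiffAt_three_comp_chart (Λ := Λ) (T := T) ρ (hℰ.of_le (by norm_num))
  obtain ⟨h1, h2, h3⟩ := B12WTReduction429.wt_chart_of_bracket e ρ hℰ h47 br hbr hspan lam c hc
  exact eq349_abstract _ _ _ _ (fun u v => B12Schur433.hessian_chart_symm ρ (hℰ.of_le (by norm_num)) u v)
    (fun u v w => B12WardThird415.fderiv_fderiv_fderiv_apply_swap_left hf3 u v w)
    (fun u v w => B12WardThird415.fderiv_fderiv_fderiv_apply_swap_right hf3 u v w) br hself lam c ℓ B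
    (fderiv_chart_apply_eq_zero e ρ (hℰ.of_le (by norm_num)) h47 hspan) h1 h2 h3

-- (the quadruply nested operator space over the iterated `Pi` type: one more level of pending instance synthesis)
set_option maxSynthPendingDepth 3 in
/-- **(I.4.7) + `C⁴` + «The group G is semisimple» ⇒ (3.49)** — `eq349_chart_of_bracket` for the charge space `V` a
finite-dimensional SEMISIMPLE real Lie algebra `𝔤` (any linear identification `eV`) represented in `𝔄` by `ρ` (`hρ`),
print's `i[·,·]` the Lie bracket: every hypothesis of `eq349_abstract` is discharged except the analytic ones (gauge
invariance (I.4.7) near `1` for all `𝔤`-valued gauge functions, `C⁴` at `1`); perfectness `[𝔤, 𝔤] = 𝔤` by name from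
`…B12Semisimple414.span_commutatorSet_eq_top_of_isSemisimple`.  At `G = SU(N)`, `N ≥ 2`:
`Literature.Algebra.Lie.SpecialUnitarySimple.isSimple_su`. [cite: Balaban1988Convergent, (3.49) p.280;
Balaban1987RG1, (4.7) p.282, (4.14)-(4.15) p.284] -/
theorem eq349_chart_of_isSemisimple {𝔤 : Type*} [LieRing 𝔤] [LieAlgebra ℝ 𝔤] [FiniteDimensional ℝ 𝔤]
    [LieAlgebra.IsSemisimple ℝ 𝔤] (eV : V ≃ₗ[ℝ] 𝔤) {ℰ : (Λ → T → 𝔄) → F} (e : Λ → T) (ρ : V →L[ℝ] 𝔄)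
    (hρ : ∀ a b : V, ρ (eV.symm ⁅eV a, eV b⁆) = ρ a * ρ b - ρ b * ρ a) (hℰ : ContDiffAt ℝ 4 ℰ 1)
    (h47 : ∀ lam : T → V, ∀ᶠ W in 𝓝 (1 : Λ → T → 𝔄), ∀ᶠ t in 𝓝 (0 : ℝ),
      ℰ (fun ν x => exp (t • ρ (lam x)) * W ν x * exp (-(t • ρ (lam (x + e ν))))) = ℰ W)
    (lam : T → V) (c ℓ B : Λ → T → V) (hc : ∀ ν y, lam (y + e ν) - lam y = c ν y) :
    fderiv ℝ (fun A : Λ → T → V => ℰ (fun ν y => exp (ρ (A ν y)))) 0 B + (2 : ℝ)⁻¹ • fderiv ℝ (fderiv ℝ (fun A : Λ → T → V => ℰ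
        (fun ν y => exp (ρ (A ν y))))) 0 B B
        + (6 : ℝ)⁻¹ • fderiv ℝ (fderiv ℝ (fderiv ℝ (fun A : Λ → T → V => ℰ (fun ν y => exp (ρ (A ν y)))))) 0 B B B
        + (24 : ℝ)⁻¹ • fderiv ℝ (fderiv ℝ (fderiv ℝ (fderiv ℝ (fun A : Λ → T → V => ℰ (fun ν y => exp (ρ (A ν y))))))) 0 B B B B =
      (2 : ℝ)⁻¹ • fderiv ℝ (fderiv ℝ (fun A : Λ → T → V => ℰ (fun ν y => exp (ρ (A ν y))))) 0
          (ℓ + (2 : ℝ)⁻¹ • fun ν y => eV.symm ⁅eV (lam y), eV (c ν y)⁆)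
          (ℓ + (2 : ℝ)⁻¹ • fun ν y => eV.symm ⁅eV (lam y), eV (c ν y)⁆)
      + (fderiv ℝ (fderiv ℝ (fun A : Λ → T → V => ℰ (fun ν y => exp (ρ (A ν y))))) 0 ℓ (B - c - ℓ)
        + (2 : ℝ)⁻¹ • fderiv ℝ (fderiv ℝ (fun A : Λ → T → V => ℰ (fun ν y => exp (ρ (A ν y))))) 0 (B - c - ℓ) (B - c - ℓ)
        + (3 : ℝ)⁻¹ • fderiv ℝ (fderiv ℝ (fun A : Λ → T → V => ℰ (fun ν y => exp (ρ (A ν y))))) 0 (B - c - ℓ)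
            (fun ν y => eV.symm ⁅eV (lam y), eV (c ν y)⁆)
        + (3 : ℝ)⁻¹ • fderiv ℝ (fderiv ℝ (fun A : Λ → T → V => ℰ (fun ν y => exp (ρ (A ν y))))) 0 (B - c)
            (fun ν y => eV.symm ⁅eV (lam y), eV ((B - c) ν y)⁆ - (2 : ℝ)⁻¹ • eV.symm ⁅eV ((B - c) ν y), eV (c ν y)⁆)
        + (6 : ℝ)⁻¹ • fderiv ℝ (fderiv ℝ (fderiv ℝ (fun A : Λ → T → V => ℰ (fun ν y => exp (ρ (A ν y)))))) 0 B B (B - c - ℓ)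
        + (6 : ℝ)⁻¹ • fderiv ℝ (fderiv ℝ (fderiv ℝ (fun A : Λ → T → V => ℰ (fun ν y => exp (ρ (A ν y)))))) 0 ℓ B (B - c)
        + (6 : ℝ)⁻¹ • fderiv ℝ (fderiv ℝ (fun A : Λ → T → V => ℰ (fun ν y => exp (ρ (A ν y))))) 0 ℓ
            (fun ν y => eV.symm ⁅eV (lam y), eV ((B - c) ν y)⁆ - (2 : ℝ)⁻¹ • eV.symm ⁅eV ((B - c) ν y), eV (c ν y)⁆)
        + (6 : ℝ)⁻¹ • fderiv ℝ (fderiv ℝ (fun A : Λ → T → V => ℰ (fun ν y => exp (ρ (A ν y))))) 0 (B - c)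
            (fun ν y => eV.symm ⁅eV (lam y), eV (ℓ ν y)⁆ - (2 : ℝ)⁻¹ • eV.symm ⁅eV (ℓ ν y), eV (c ν y)⁆)
        + (8 : ℝ)⁻¹ • fderiv ℝ (fderiv ℝ (fun A : Λ → T → V => ℰ (fun ν y => exp (ρ (A ν y))))) 0
            (fun ν y => eV.symm ⁅eV (lam y), eV (c ν y)⁆)
            (fun ν y => eV.symm ⁅eV (lam y), eV ((B - c) ν y)⁆ - (2 : ℝ)⁻¹ • eV.symm ⁅eV ((B - c) ν y), eV (c ν y)⁆)
        + (8 : ℝ)⁻¹ • fderiv ℝ (fderiv ℝ (fun A : Λ → T → V => ℰ (fun ν y => exp (ρ (A ν y))))) 0 (B - c)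
            (fun ν y => eV.symm ⁅eV (lam y), eV (eV.symm ⁅eV (lam y), eV (c ν y)⁆)⁆
              - (2 : ℝ)⁻¹ • eV.symm ⁅eV (eV.symm ⁅eV (lam y), eV (c ν y)⁆), eV (c ν y)⁆)
        + (8 : ℝ)⁻¹ • fderiv ℝ (fderiv ℝ (fderiv ℝ (fun A : Λ → T → V => ℰ (fun ν y => exp (ρ (A ν y)))))) 0
            (fun ν y => eV.symm ⁅eV (lam y), eV (c ν y)⁆) B
            (B - c)
        + (8 : ℝ)⁻¹ • fderiv ℝ (fderiv ℝ (fderiv ℝ (fun A : Λ → T → V => ℰ (fun ν y => exp (ρ (A ν y)))))) 0 B B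
            (fun ν y => eV.symm ⁅eV (lam y), eV ((B - c) ν y)⁆ - (2 : ℝ)⁻¹ • eV.symm ⁅eV ((B - c) ν y), eV (c ν y)⁆)
        - (48 : ℝ)⁻¹ • fderiv ℝ (fderiv ℝ (fun A : Λ → T → V => ℰ (fun ν y => exp (ρ (A ν y))))) 0 B
            (fun ν y => eV.symm ⁅eV (B ν y), eV (eV.symm ⁅eV ((B - c) ν y), eV (c ν y)⁆)⁆)
        + (24 : ℝ)⁻¹ • fderiv ℝ (fderiv ℝ (fderiv ℝ (fderiv ℝ (fun A : Λ → T → V => ℰ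
            (fun ν y => exp (ρ (A ν y))))))) 0 B B B (B - c)) := by
  simpa only [LinearMap.mk₂_apply] using eq349_chart_of_bracket e ρ hℰ h47
    (LinearMap.mk₂ ℝ (fun a b => eV.symm ⁅eV a, eV b⁆) (fun _ _ _ => by simp) (fun _ _ _ => by simp)
      (fun _ _ _ => by simp) (fun _ _ _ => by simp)) hρ (fun a => by simp)
    (B12Semisimple414.span_commutatorSet_eq_top_of_isSemisimple eV ρ hρ) lam c ℓ B hc

end Chart

/-! ## §5. The main term in print's displayed form: the scalar kernel table and the second moments
`Σ_{x,y} 𝐄^{(2)}_{μν}(X,x,y,z)(x_κ−z_κ)(y_λ−z_λ)` against `½ tr((∂_κB_μ)(z) + ½i[B_κ(z),B_μ(z)])((∂_λB_ν)(z) + ½i[B_λ(z),B_ν(z)])` -/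

section Display

variable {Λ T : Type*} [Fintype Λ] [Fintype T] {V : Type*} [NormedAddCommGroup V] [NormedSpace ℝ V]
  {F : Type*} [NormedAddCommGroup F] [NormedSpace ℝ F]

omit [Fintype T] in
/-- The field of the main term at a bond `(μ, x)`: with `ℓ_μ(x) = Σ_κ (x_κ − z_κ)(∂_κB_μ)(z)` (`hℓ`),
`λ_z(x) = Σ_κ (x_κ − z_κ)B_κ(z)` (`hlam`) and `c = B(z)` (`hc`),
`(ℓ + ½ i[λ_z, B(z)])_μ(x) = Σ_κ (x_κ − z_κ)·((∂_κB_μ)(z) + ½ i[B_κ(z), B_μ(z)])` — «we move the factors B to the point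
z». [cite: Balaban1988Convergent, (3.49) p.280] -/
theorem mainField_apply (br : V →ₗ[ℝ] V →ₗ[ℝ] V) (disp : T → Λ → ℝ) (dB : Λ → Λ → V) (Bz : Λ → V)
    (lam : T → V) (c ℓ : Λ → T → V) (hlam : ∀ x, lam x = ∑ κ, disp x κ • Bz κ) (hc : ∀ μ x, c μ x = Bz μ)
    (hℓ : ∀ μ x, ℓ μ x = ∑ κ, disp x κ • dB κ μ) (μ : Λ) (x : T) :
    (ℓ + (2 : ℝ)⁻¹ • fun ν y => br (lam y) (c ν y)) μ x
      = ∑ κ, disp x κ • (dB κ μ + (2 : ℝ)⁻¹ • br (Bz κ) (Bz μ)) := by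
  simp only [Pi.add_apply, Pi.smul_apply, hℓ, hlam, hc, map_sum, map_smul, LinearMap.sum_apply,
    LinearMap.smul_apply]
  rw [Finset.smul_sum, ← Finset.sum_add_distrib]
  exact Finset.sum_congr rfl fun κ _ => by module

/-- Finite sums commute: `Σ_x Σ_y Σ_κ Σ_θ = Σ_κ Σ_θ Σ_x Σ_y`. [folklore] -/
private theorem sum4_comm {α β γ δ : Type*} [Fintype α] [Fintype β] [Fintype γ] [Fintype δ] {M : Type*}
    [AddCommMonoid M] (f : α → β → γ → δ → M) :
    ∑ x, ∑ y, ∑ κ, ∑ θ, f x y κ θ = ∑ κ, ∑ θ, ∑ x, ∑ y, f x y κ θ := by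
  calc ∑ x, ∑ y, ∑ κ, ∑ θ, f x y κ θ = ∑ x, ∑ κ, ∑ y, ∑ θ, f x y κ θ :=
        Finset.sum_congr rfl fun x _ => Finset.sum_comm
    _ = ∑ κ, ∑ x, ∑ y, ∑ θ, f x y κ θ := Finset.sum_comm
    _ = ∑ κ, ∑ x, ∑ θ, ∑ y, f x y κ θ :=
        Finset.sum_congr rfl fun κ _ => Finset.sum_congr rfl fun x _ => Finset.sum_comm
    _ = ∑ κ, ∑ θ, ∑ x, ∑ y, f x y κ θ := Finset.sum_congr rfl fun κ _ => Finset.sum_comm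

/-- **The main term of (3.49) IN PRINT'S FORM.**  If the second tower is given by a SCALAR kernel table against a
bilinear form `tr2` — `⟨E2, u, v⟩ = Σ_{μ,ν,x,y} 𝐄^{(2)}_{μν}(X,x,y,z) tr(u_μ(x)v_ν(y))` (print p. 289 [I]: «⟨𝐄, A⊗B⟩ =
𝐄 tr AB», the Schur reduction `…B12Schur433` / (3.50); here `K μ ν x y` and any `tr2`) — and `ℓ`, `λ_z`, `c` are the
Taylor data of `B` at `z` with displacements `disp x κ = x_κ − z_κ`, `dB κ μ = (∂_κB_μ)(z)`, `Bz μ = B_μ(z)`, then the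
main term `½⟨E2, ℓ + ½i[λ_z,B(z)], ℓ + ½i[λ_z,B(z)]⟩` of `eq349_abstract` EQUALS
  `Σ_{μ,ν,κ,λ} [Σ_{x,y} 𝐄^{(2)}_{μν}(X,x,y,z)(x_κ − z_κ)(y_λ − z_λ)] · ½ tr((∂_κB_μ)(z) + ½i[B_κ(z),B_μ(z)])((∂_λB_ν)(z) + ½i[B_λ(z),B_ν(z)])`,
the right-hand side of (3.49) as displayed (for `V = 𝔤 ⊂ M_N(ℂ)`, `tr2 = Re tr(·×·)`, `br = i[·,·]` this is
`…B14.Eq350Kernel.main349` with `K` the kernel table over the window).  Finite sums only.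
[cite: Balaban1988Convergent, (3.49)-(3.50) p.280; Balaban1987RG1, (4.33)-(4.34) p.289] -/
theorem main349_display (E2 : (Λ → T → V) →L[ℝ] (Λ → T → V) →L[ℝ] F) (K : Λ → Λ → T → T → ℝ)
    (tr2 : V →ₗ[ℝ] V →ₗ[ℝ] F) (hE2 : ∀ u v, E2 u v = ∑ μ, ∑ ν, ∑ x, ∑ y, K μ ν x y • tr2 (u μ x) (v ν y))
    (br : V →ₗ[ℝ] V →ₗ[ℝ] V) (disp : T → Λ → ℝ) (dB : Λ → Λ → V) (Bz : Λ → V)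
    (lam : T → V) (c ℓ : Λ → T → V) (hlam : ∀ x, lam x = ∑ κ, disp x κ • Bz κ) (hc : ∀ μ x, c μ x = Bz μ)
    (hℓ : ∀ μ x, ℓ μ x = ∑ κ, disp x κ • dB κ μ) :
    (2 : ℝ)⁻¹ • E2 (ℓ + (2 : ℝ)⁻¹ • fun ν y => br (lam y) (c ν y)) (ℓ + (2 : ℝ)⁻¹ • fun ν y => br (lam y) (c ν y))
      = ∑ μ, ∑ ν, ∑ κ, ∑ θ, (∑ x, ∑ y, K μ ν x y * ((disp x κ) * (disp y θ))) •
          ((2 : ℝ)⁻¹ • tr2 (dB κ μ + (2 : ℝ)⁻¹ • br (Bz κ) (Bz μ)) (dB θ ν + (2 : ℝ)⁻¹ • br (Bz θ) (Bz ν))) := by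
  set G : Λ → T → V := ℓ + (2 : ℝ)⁻¹ • fun ν y => br (lam y) (c ν y) with hGdef
  have hG : ∀ μ x, G μ x = ∑ κ, disp x κ • (dB κ μ + (2 : ℝ)⁻¹ • br (Bz κ) (Bz μ)) := fun μ x =>
    mainField_apply br disp dB Bz lam c ℓ hlam hc hℓ μ x
  rw [hE2]
  simp only [hG, map_sum, map_smul, LinearMap.sum_apply, LinearMap.smul_apply, Finset.smul_sum, smul_smul,
    Finset.sum_smul, Finset.sum_mul]
  refine Finset.sum_congr rfl fun μ _ => Finset.sum_congr rfl fun ν _ => ?_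
  -- the sums over the sites `x, y` inside, the displacement indices outside (finite sums commute)
  rw [sum4_comm]
  refine Finset.sum_comm.trans ?_
  refine Finset.sum_congr rfl fun κ _ => Finset.sum_congr rfl fun θ _ => Finset.sum_congr rfl fun x _ =>
    Finset.sum_congr rfl fun y _ => ?_
  congr 1
  ring

end Display

/-! ## §6. The row's decl of record `B14.Eq350Kernel.Eq349` INHABITED: (3.49) for a function `F` of the matrix-valued
bond field whose derivative towers satisfy (I.4.14), (I.4.15) and whose Hessian is a scalar kernel table -/

section DisplayLetter

variable {Λ T : Type*} [Fintype Λ] [Fintype T] {V : Type*} [NormedAddCommGroup V] [NormedSpace ℝ V]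
  {F : Type*} [NormedAddCommGroup F] [NormedSpace ℝ F]

/-- `main349_display` with the half-terms `(∂_κB_μ)(z) + ½ i[B_κ(z), B_μ(z)]` abbreviated by a letter `P` (`hP`).
[cite: Balaban1988Convergent, (3.49) p.280] -/
theorem main349_display' (E2 : (Λ → T → V) →L[ℝ] (Λ → T → V) →L[ℝ] F) (K : Λ → Λ → T → T → ℝ)
    (tr2 : V →ₗ[ℝ] V →ₗ[ℝ] F) (hE2 : ∀ u v, E2 u v = ∑ μ, ∑ ν, ∑ x, ∑ y, K μ ν x y • tr2 (u μ x) (v ν y))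
    (br : V →ₗ[ℝ] V →ₗ[ℝ] V) (disp : T → Λ → ℝ) (dB : Λ → Λ → V) (Bz : Λ → V)
    (lam : T → V) (c ℓ : Λ → T → V) (hlam : ∀ x, lam x = ∑ κ, disp x κ • Bz κ) (hc : ∀ μ x, c μ x = Bz μ)
    (hℓ : ∀ μ x, ℓ μ x = ∑ κ, disp x κ • dB κ μ) (P : Λ → Λ → V)
    (hP : ∀ κ μ, P κ μ = dB κ μ + (2 : ℝ)⁻¹ • br (Bz κ) (Bz μ)) :
    (2 : ℝ)⁻¹ • E2 (ℓ + (2 : ℝ)⁻¹ • fun ν y => br (lam y) (c ν y)) (ℓ + (2 : ℝ)⁻¹ • fun ν y => br (lam y) (c ν y))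
      = ∑ μ, ∑ ν, ∑ κ, ∑ θ, (∑ x, ∑ y, K μ ν x y * ((disp x κ) * (disp y θ))) •
          ((2 : ℝ)⁻¹ • tr2 (P κ μ) (P θ ν)) := by
  rw [main349_display E2 K tr2 hE2 br disp dB Bz lam c ℓ hlam hc hℓ]
  simp only [hP]

end DisplayLetter

section OfRecord

open Eq350Kernel Eq356FieldStrength

variable {d : ℕ} {X : Type*} [Fintype X] {m : Type*} [Fintype m] [DecidableEq m]

attribute [local instance] Matrix.linftyOpNormedAddCommGroup Matrix.linftyOpNormedSpace

omit [Fintype X] [DecidableEq m] in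
/-- `halfTerm` of `…B14.Eq356FieldStrength` — print's `(∂_κB_μ)(z) + ½ i[B_κ(z), B_μ(z)]` — in the real-scalar form used
by the towers: `dB κ μ + ½ • (i • (B_κB_μ − B_μB_κ))`. [cite: Balaban1988Convergent, (3.49) p.280] -/
theorem halfTerm_eq_real_smul (dB : Fin d → Fin d → Matrix m m ℂ) (Bz : Fin d → Matrix m m ℂ) (κ μ : Fin d) :
    halfTerm dB Bz κ μ = dB κ μ + (2 : ℝ)⁻¹ • (Complex.I • (Bz κ * Bz μ - Bz μ * Bz κ)) := by
  unfold halfTerm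
  congr 1
  ext i j
  simp only [Matrix.smul_apply, smul_eq_mul, Complex.real_smul, Complex.ofReal_inv, Complex.ofReal_ofNat]
  ring

omit [DecidableEq m] in
/-- `⟨𝐄^{(n)}, ⊗ⁿB⟩` of `…B14.Eq350Kernel` (Mathlib's `iteratedFDeriv` of `F` on the UNCURRIED bond field) read on the
curried field `A_μ(x) = B(μ, x)`: `dTensor F n B = Dⁿ(F ∘ uncurry)(0)(A, …, A)`. [cite: Balaban1988Convergent, (3.49) p.280] -/
theorem dTensor_eq_curried (F : (Fin d × X → Matrix m m ℂ) → ℝ) (B : Fin d × X → Matrix m m ℂ) (n : ℕ) :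
    dTensor F n B = iteratedFDeriv ℝ n (fun A' : Fin d → X → Matrix m m ℂ => F (fun p => A' p.1 p.2)) 0
      (fun _ => fun μ x => B (μ, x)) := by
  let U : (Fin d → X → Matrix m m ℂ) ≃L[ℝ] (Fin d × X → Matrix m m ℂ) :=
    { toFun := fun A' p => A' p.1 p.2
      map_add' := fun _ _ => rfl
      map_smul' := fun _ _ => rfl
      invFun := fun B' μ x => B' (μ, x)
      left_inv := fun _ => rfl
      right_inv := fun _ => rfl
      continuous_toFun := continuous_pi fun p => (continuous_apply p.2).comp (continuous_apply p.1)
      continuous_invFun := continuous_pi fun μ => continuous_pi fun x => continuous_apply (μ, x) }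
  have h := U.iteratedFDerivWithin_comp_right F uniqueDiffOn_univ (x := 0) (Set.mem_univ _) n
  rw [Set.preimage_univ, iteratedFDerivWithin_univ, iteratedFDerivWithin_univ, map_zero] at h
  have h' := congrArg (fun Φ => Φ (fun _ => fun μ x => B (μ, x))) h
  simp only [Function.comp_def, ContinuousMultilinearMap.compContinuousLinearMap_apply] at h'
  exact h'.symm

-- (the quadruply nested operator space over the iterated `Pi` type: one more level of pending instance synthesis)
set_option maxSynthPendingDepth 3 in
/-- **The decl of record `B14.Eq350Kernel.Eq349` inhabited** — (3.49) WITH ITS PRINTED TWO SIDES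
(`taylor4 F B = Σ_{n=1}^{4}(1/n!)⟨𝐄^{(n)}, ⊗ⁿB⟩` via Mathlib's `iteratedFDeriv`; `main349` = the displayed
`Σ_{μνκλ}[Σ_{x,y}𝐄^{(2)}_{μν}(x,y)(x_κ−z_κ)(y_λ−z_λ)]·½Re tr(halfTerm_{κμ}halfTerm_{λν})` over the window of all pairs) and an
EXPLICIT irrelevant term `R = R₁ + ⋯ + R₁₄`, for a real function `F` of the matrix-valued bond field `B : Fin d × X →
M_m(ℂ)` (model: `F(B) = 𝐄^{(j)}(X, U_j(exp iB), z)`) such that `f(A) = F(uncurry A)` is `C⁴` at `0` (`hF`; the slot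
symmetries are then Schwarz), (I.4.14) `Df(0) = 0` (`h14`) and (I.4.15)₁,₂,₃ at `B = 0` hold in the shapes of
`…B12WTReduction429` with the bracket `i[a, b] = i(ab − ba)` and `∂λ_z ↦ c` (`h1`, `h2`, `h3`), and the Hessian is a
scalar kernel table `K` against `Re tr` (`hE2`, the (3.50) / (I.4.33) reading); the Taylor data at `z`: `c = B(z)`
(`hc`), `λ_z(x) = Σ_κ(x_κ − z_κ)B_κ(z)` (`hlam`), `ℓ_μ(x) = Σ_κ(x_κ − z_κ)dB_{κμ}` (`hℓ`; `dB` intended `fwdDerivAt`),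
`A_μ(x) = B(μ, x)` (`hA`).  For `𝔤`-valued fields and `F` the chart functional of a gauge-invariant `C⁴` `𝐄`, §4
discharges `h14`, `h1`–`h3`. [cite: Balaban1988Convergent, (3.49)-(3.50) p.280, p.281; Balaban1987RG1,
(4.14)-(4.15) p.284] -/
theorem eq349_of_record (F : (Fin d × X → Matrix m m ℂ) → ℝ) (B : Fin d × X → Matrix m m ℂ)
    (K : Fin d → Fin d → X → X → ℝ) (coord : X → Fin d → ℝ) (z : X) (dB : Fin d → Fin d → Matrix m m ℂ)
    (hF : ContDiffAt ℝ 4 (fun A' : Fin d → X → Matrix m m ℂ => F (fun p => A' p.1 p.2)) 0)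
    (hE2 : ∀ u v, fderiv ℝ (fderiv ℝ (fun A' : Fin d → X → Matrix m m ℂ => F (fun p => A' p.1 p.2))) 0 u v = ∑ μ, ∑ ν, ∑ x, ∑ y, K μ ν x y * ((u μ x * v ν y).trace).re)
    (lam : X → Matrix m m ℂ) (A c ℓ : Fin d → X → Matrix m m ℂ)
    (hA : A = fun μ x => B (μ, x)) (hc : ∀ μ x, c μ x = B (μ, z))
    (hlam : ∀ x, lam x = ∑ κ, (coord x κ - coord z κ) • B (κ, z))
    (hℓ : ∀ μ x, ℓ μ x = ∑ κ, (coord x κ - coord z κ) • dB κ μ)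
    (h14 : ∀ u, fderiv ℝ (fun A' : Fin d → X → Matrix m m ℂ => F (fun p => A' p.1 p.2)) 0 u = 0) (h1 : ∀ u, fderiv ℝ (fderiv ℝ (fun A' : Fin d → X → Matrix m m ℂ => F (fun p => A' p.1 p.2))) 0 u c = 0)
    (h2 : ∀ u v, fderiv ℝ (fderiv ℝ (fderiv ℝ (fun A' : Fin d → X → Matrix m m ℂ => F (fun p => A' p.1 p.2)))) 0 u v c
      - fderiv ℝ (fderiv ℝ (fun A' : Fin d → X → Matrix m m ℂ => F (fun p => A' p.1 p.2))) 0 u (fun ν y => Complex.I • (lam y * v ν y - v ν y * lam y)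
          - (2 : ℝ)⁻¹ • (Complex.I • (v ν y * c ν y - c ν y * v ν y)))
      - fderiv ℝ (fderiv ℝ (fun A' : Fin d → X → Matrix m m ℂ => F (fun p => A' p.1 p.2))) 0 v (fun ν y => Complex.I • (lam y * u ν y - u ν y * lam y)
          - (2 : ℝ)⁻¹ • (Complex.I • (u ν y * c ν y - c ν y * u ν y))) = 0)
    (h3 : ∀ u₁ u₂ u₃, fderiv ℝ (fderiv ℝ (fderiv ℝ (fderiv ℝ
      (fun A' : Fin d → X → Matrix m m ℂ => F (fun p => A' p.1 p.2))))) 0 u₁ u₂ u₃ c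
      - fderiv ℝ (fderiv ℝ (fderiv ℝ (fun A' : Fin d → X → Matrix m m ℂ => F (fun p => A' p.1 p.2)))) 0 u₁ u₂ (fun ν y => Complex.I • (lam y * u₃ ν y - u₃ ν y * lam y)
          - (2 : ℝ)⁻¹ • (Complex.I • (u₃ ν y * c ν y - c ν y * u₃ ν y)))
      - fderiv ℝ (fderiv ℝ (fderiv ℝ (fun A' : Fin d → X → Matrix m m ℂ => F (fun p => A' p.1 p.2)))) 0 u₁ u₃ (fun ν y => Complex.I • (lam y * u₂ ν y - u₂ ν y * lam y)
          - (2 : ℝ)⁻¹ • (Complex.I • (u₂ ν y * c ν y - c ν y * u₂ ν y)))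
      - fderiv ℝ (fderiv ℝ (fderiv ℝ (fun A' : Fin d → X → Matrix m m ℂ => F (fun p => A' p.1 p.2)))) 0 u₂ u₃ (fun ν y => Complex.I • (lam y * u₁ ν y - u₁ ν y * lam y)
          - (2 : ℝ)⁻¹ • (Complex.I • (u₁ ν y * c ν y - c ν y * u₁ ν y)))
      + fderiv ℝ (fderiv ℝ (fun A' : Fin d → X → Matrix m m ℂ => F (fun p => A' p.1 p.2))) 0 u₁ (fun ν y => (12 : ℝ)⁻¹ • (Complex.I • (u₂ ν y * (Complex.I • (u₃ ν y * c ν y - c ν y * u₃ ν y))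
            - (Complex.I • (u₃ ν y * c ν y - c ν y * u₃ ν y)) * u₂ ν y)
          + Complex.I • (u₃ ν y * (Complex.I • (u₂ ν y * c ν y - c ν y * u₂ ν y))
            - (Complex.I • (u₂ ν y * c ν y - c ν y * u₂ ν y)) * u₃ ν y)))
      + fderiv ℝ (fderiv ℝ (fun A' : Fin d → X → Matrix m m ℂ => F (fun p => A' p.1 p.2))) 0 u₂ (fun ν y => (12 : ℝ)⁻¹ • (Complex.I • (u₁ ν y * (Complex.I • (u₃ ν y * c ν y - c ν y * u₃ ν y))
            - (Complex.I • (u₃ ν y * c ν y - c ν y * u₃ ν y)) * u₁ ν y)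
          + Complex.I • (u₃ ν y * (Complex.I • (u₁ ν y * c ν y - c ν y * u₁ ν y))
            - (Complex.I • (u₁ ν y * c ν y - c ν y * u₁ ν y)) * u₃ ν y)))
      + fderiv ℝ (fderiv ℝ (fun A' : Fin d → X → Matrix m m ℂ => F (fun p => A' p.1 p.2))) 0 u₃ (fun ν y => (12 : ℝ)⁻¹ • (Complex.I • (u₁ ν y * (Complex.I • (u₂ ν y * c ν y - c ν y * u₂ ν y))
            - (Complex.I • (u₂ ν y * c ν y - c ν y * u₂ ν y)) * u₁ ν y)
          + Complex.I • (u₂ ν y * (Complex.I • (u₁ ν y * c ν y - c ν y * u₁ ν y))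
            - (Complex.I • (u₁ ν y * c ν y - c ν y * u₁ ν y)) * u₂ ν y)))
      = 0) :
    Eq349 F B K (Finset.univ ×ˢ Finset.univ) coord z dB (valueAt B z)
      (fderiv ℝ (fderiv ℝ (fun A' : Fin d → X → Matrix m m ℂ => F (fun p => A' p.1 p.2))) 0 ℓ (A - c - ℓ) + (2 : ℝ)⁻¹ • fderiv ℝ (fderiv ℝ (fun A' : Fin d → X → Matrix m m ℂ => F (fun p => A' p.1 p.2))) 0 (A - c - ℓ) (A - c - ℓ)
        + (3 : ℝ)⁻¹ • fderiv ℝ (fderiv ℝ (fun A' : Fin d → X → Matrix m m ℂ => F (fun p => A' p.1 p.2))) 0 (A - c - ℓ) (fun ν y => Complex.I • (lam y * c ν y - c ν y * lam y))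
        + (3 : ℝ)⁻¹ • fderiv ℝ (fderiv ℝ (fun A' : Fin d → X → Matrix m m ℂ => F (fun p => A' p.1 p.2))) 0 (A - c) (fun ν y => Complex.I • (lam y * (A - c) ν y - (A - c) ν y * lam y)
            - (2 : ℝ)⁻¹ • (Complex.I • ((A - c) ν y * c ν y - c ν y * (A - c) ν y)))
        + (6 : ℝ)⁻¹ • fderiv ℝ (fderiv ℝ (fderiv ℝ (fun A' : Fin d → X → Matrix m m ℂ => F (fun p => A' p.1 p.2)))) 0 A A (A - c - ℓ)
        + (6 : ℝ)⁻¹ • fderiv ℝ (fderiv ℝ (fderiv ℝ (fun A' : Fin d → X → Matrix m m ℂ => F (fun p => A' p.1 p.2)))) 0 ℓ A (A - c)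
        + (6 : ℝ)⁻¹ • fderiv ℝ (fderiv ℝ (fun A' : Fin d → X → Matrix m m ℂ => F (fun p => A' p.1 p.2))) 0 ℓ (fun ν y => Complex.I • (lam y * (A - c) ν y - (A - c) ν y * lam y)
            - (2 : ℝ)⁻¹ • (Complex.I • ((A - c) ν y * c ν y - c ν y * (A - c) ν y)))
        + (6 : ℝ)⁻¹ • fderiv ℝ (fderiv ℝ (fun A' : Fin d → X → Matrix m m ℂ => F (fun p => A' p.1 p.2))) 0 (A - c) (fun ν y => Complex.I • (lam y * ℓ ν y - ℓ ν y * lam y)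
            - (2 : ℝ)⁻¹ • (Complex.I • (ℓ ν y * c ν y - c ν y * ℓ ν y)))
        + (8 : ℝ)⁻¹ • fderiv ℝ (fderiv ℝ (fun A' : Fin d → X → Matrix m m ℂ => F (fun p => A' p.1 p.2))) 0 (fun ν y => Complex.I • (lam y * c ν y - c ν y * lam y))
            (fun ν y => Complex.I • (lam y * (A - c) ν y - (A - c) ν y * lam y)
              - (2 : ℝ)⁻¹ • (Complex.I • ((A - c) ν y * c ν y - c ν y * (A - c) ν y)))
        + (8 : ℝ)⁻¹ • fderiv ℝ (fderiv ℝ (fun A' : Fin d → X → Matrix m m ℂ => F (fun p => A' p.1 p.2))) 0 (A - c)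
            (fun ν y => Complex.I • (lam y * (Complex.I • (lam y * c ν y - c ν y * lam y))
                - (Complex.I • (lam y * c ν y - c ν y * lam y)) * lam y)
              - (2 : ℝ)⁻¹ • (Complex.I • ((Complex.I • (lam y * c ν y - c ν y * lam y)) * c ν y
                - c ν y * (Complex.I • (lam y * c ν y - c ν y * lam y)))))
        + (8 : ℝ)⁻¹ • fderiv ℝ (fderiv ℝ (fderiv ℝ (fun A' : Fin d → X → Matrix m m ℂ => F (fun p => A' p.1 p.2)))) 0 (fun ν y => Complex.I • (lam y * c ν y - c ν y * lam y)) A (A - c)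
        + (8 : ℝ)⁻¹ • fderiv ℝ (fderiv ℝ (fderiv ℝ (fun A' : Fin d → X → Matrix m m ℂ => F (fun p => A' p.1 p.2)))) 0 A A (fun ν y => Complex.I • (lam y * (A - c) ν y - (A - c) ν y * lam y)
            - (2 : ℝ)⁻¹ • (Complex.I • ((A - c) ν y * c ν y - c ν y * (A - c) ν y)))
        - (48 : ℝ)⁻¹ • fderiv ℝ (fderiv ℝ (fun A' : Fin d → X → Matrix m m ℂ => F (fun p => A' p.1 p.2))) 0 A (fun ν y => Complex.I • (A ν y * (Complex.I • ((A - c) ν y * c ν y - c ν y * (A - c) ν y))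
            - (Complex.I • ((A - c) ν y * c ν y - c ν y * (A - c) ν y)) * A ν y))
        + (24 : ℝ)⁻¹ • fderiv ℝ (fderiv ℝ (fderiv ℝ (fderiv ℝ
      (fun A' : Fin d → X → Matrix m m ℂ => F (fun p => A' p.1 p.2))))) 0 A A A (A - c)) := by
  -- the bracket `i[a,b] = i(ab − ba)` and the trace form `Re tr(ab)` as ℝ-bilinear maps
  let br : Matrix m m ℂ →ₗ[ℝ] Matrix m m ℂ →ₗ[ℝ] Matrix m m ℂ :=
    LinearMap.mk₂ ℝ (fun a b => Complex.I • (a * b - b * a))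
      (fun a a' b => by rw [← smul_add]; congr 1; simp only [add_mul, mul_add]; abel)
      (fun t a b => by rw [smul_mul_assoc, mul_smul_comm, ← smul_sub, smul_comm])
      (fun a b b' => by rw [← smul_add]; congr 1; simp only [add_mul, mul_add]; abel)
      (fun t a b => by rw [mul_smul_comm, smul_mul_assoc, ← smul_sub, smul_comm])
  have hself : ∀ a, br a a = 0 := fun a => by
    show Complex.I • (a * a - a * a) = 0
    rw [sub_self, smul_zero]
  let tr2 : Matrix m m ℂ →ₗ[ℝ] Matrix m m ℂ →ₗ[ℝ] ℝ :=
    LinearMap.mk₂ ℝ (fun a b => ((a * b).trace).re)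
      (fun a a' b => by simp only [add_mul, Matrix.trace_add, Complex.add_re])
      (fun t a b => by simp only [smul_mul_assoc, Matrix.trace_smul, Complex.smul_re, smul_eq_mul])
      (fun a b b' => by simp only [mul_add, Matrix.trace_add, Complex.add_re])
      (fun t a b => by simp only [mul_smul_comm, Matrix.trace_smul, Complex.smul_re, smul_eq_mul])
  have htr2 : ∀ a b, tr2 a b = ((a * b).trace).re := fun a b => rfl
  -- the slot symmetries (Schwarz)
  have hF3 : ContDiffAt ℝ 3 (fun A' : Fin d → X → Matrix m m ℂ => F (fun p => A' p.1 p.2)) 0 := hF.of_le (by norm_num)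
  have hs2 : ∀ u v, fderiv ℝ (fderiv ℝ (fun A' : Fin d → X → Matrix m m ℂ => F (fun p => A' p.1 p.2))) 0 u v = fderiv ℝ (fderiv ℝ (fun A' : Fin d → X → Matrix m m ℂ => F (fun p => A' p.1 p.2))) 0 v u :=
    fun u v => ((hF.of_le (by norm_num) : ContDiffAt ℝ 2 (fun A' : Fin d → X → Matrix m m ℂ => F (fun p => A' p.1 p.2)) 0).isSymmSndFDerivAt (by simp)) u v
  -- §2 for the towers of `f`, with this bracket (every hypothesis is accepted up to unfolding of `br`)
  have H := eq349_abstract (fderiv ℝ (fun A' : Fin d → X → Matrix m m ℂ => F (fun p => A' p.1 p.2)) 0) (fderiv ℝ (fderiv ℝ (fun A' : Fin d → X → Matrix m m ℂ => F (fun p => A' p.1 p.2))) 0) (fderiv ℝ (fderiv ℝ (fderiv ℝ (fun A' : Fin d → X → Matrix m m ℂ => F (fun p => A' p.1 p.2)))) 0) (fderiv ℝ (fderiv ℝ (fderiv ℝ (fderiv ℝ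
      (fun A' : Fin d → X → Matrix m m ℂ => F (fun p => A' p.1 p.2))))) 0) hs2
    (fun u v w => B12WardThird415.fderiv_fderiv_fderiv_apply_swap_left hF3 u v w)
    (fun u v w => B12WardThird415.fderiv_fderiv_fderiv_apply_swap_right hF3 u v w) br hself lam c ℓ A h14 h1 h2 h3
  -- the left-hand side: `taylor4 F B` is the curried sum
  have T : taylor4 F B = fderiv ℝ (fun A' : Fin d → X → Matrix m m ℂ => F (fun p => A' p.1 p.2)) 0 A + (2 : ℝ)⁻¹ * fderiv ℝ (fderiv ℝ (fun A' : Fin d → X → Matrix m m ℂ => F (fun p => A' p.1 p.2))) 0 A A + (6 : ℝ)⁻¹ * fderiv ℝ (fderiv ℝ (fderiv ℝ (fun A' : Fin d → X → Matrix m m ℂ => F (fun p => A' p.1 p.2)))) 0 A A A + (24 : ℝ)⁻¹ * fderiv ℝ (fderiv ℝ (fderiv ℝ (fderiv ℝ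
      (fun A' : Fin d → X → Matrix m m ℂ => F (fun p => A' p.1 p.2))))) 0 A A A A := by
    subst hA
    rw [taylor4_eq, dTensor_eq_curried, dTensor_eq_curried, dTensor_eq_curried, dTensor_eq_curried,
      show (1 / 2 : ℝ) = (2 : ℝ)⁻¹ by norm_num, show (1 / 6 : ℝ) = (6 : ℝ)⁻¹ by norm_num,
      show (1 / 24 : ℝ) = (24 : ℝ)⁻¹ by norm_num]
    have h4 := taylor4_diag_eq (fun A' : Fin d → X → Matrix m m ℂ => F (fun p => A' p.1 p.2)) (fun μ x => B (μ, x))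
    simp only [smul_eq_mul] at h4
    -- (the two sides now agree up to unfolding of the instance paths on the matrix-valued bond fields)
    exact h4
  -- the main term is print's display `main349` (§5, with `halfTerm` as the letter `P`)
  have M := main349_display' (fderiv ℝ (fderiv ℝ (fun A' : Fin d → X → Matrix m m ℂ => F (fun p => A' p.1 p.2))) 0) K tr2 hE2 br (fun x κ => coord x κ - coord z κ) dB (valueAt B z) lam c ℓ
    hlam hc hℓ (halfTerm dB (valueAt B z)) (fun κ μ => halfTerm_eq_real_smul dB (valueAt B z) κ μ)
  have Mn : main349 K (Finset.univ ×ˢ Finset.univ) coord z dB (valueAt B z)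
      = ∑ μ, ∑ ν, ∑ κ, ∑ θ, (∑ x, ∑ y, K μ ν x y * ((coord x κ - coord z κ) * (coord y θ - coord z θ))) •
          ((2 : ℝ)⁻¹ • tr2 (halfTerm dB (valueAt B z) κ μ) (halfTerm dB (valueAt B z) θ ν)) := by
    rw [main349]
    refine Finset.sum_congr rfl fun μ _ => Finset.sum_congr rfl fun ν _ => Finset.sum_congr rfl fun κ _ =>
      Finset.sum_congr rfl fun θ _ => ?_
    rw [moment2, Finset.sum_product, pairTrace, smul_eq_mul, smul_eq_mul, htr2]
    have e : (∑ x, ∑ y, K μ ν x y * ((coord x κ - coord z κ) * (coord y θ - coord z θ)))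
        = ∑ x, ∑ y, K μ ν x y * (coord x κ - coord z κ) * (coord y θ - coord z θ) := by
      simp only [mul_assoc]
    rw [e]
    ring
  -- assemble: the three identities are composed by unification (the remainder terms agree up to unfolding)
  unfold Eq349
  refine T.trans (H.trans ?_)
  refine congrArg₂ (· + ·) (M.trans Mn.symm) ?_
  rfl

end OfRecord

end Literature.MathematicalPhysics.QuantumFieldTheory.Balaban1983to89.B14.Eq349WardReduction
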